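import Literature.NumberTheory.LFunctions.LiCoefficientsModelSpaceProofs
import HarnessLib

/-!
# Li coefficients as norms of functions in a model space (Suzuki 2023) — the identity (3.8) under RH

LINE 1 — LABEL: RH-CONSEQUENCE proofs. Every theorem of this file that mentions the zeros carries
the explicit binder `RiemannHypothesis →` (never dropped, never an instance); the RH-free lemmas
are complex-analytic generalities (a contour lemma for the upper half-plane, local germs of
`ξ/((ξ+ξ′)(s−ρ))` at the zeros). This file DISCHARGES the boundary statement
`Suzuki2023b_eq_s301` (= [Su23b] eq. (3.8): under RH, `Σ_ρ m_ρ{[1−(1−1/ρ)ⁿ]+[1−(1−1/(1−ρ))ⁿ]} =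
‖G_n‖²/π`) and with it Theorem 1.1 (`Suzuki2023b_thm11_onlyif`, `Suzuki2023b_thm11`) of
M. Suzuki, *Li coefficients as norms of functions in a model space*, J. Number Theory 252 (2023)
177–194. WHAT THIS IS NOT: not a route, not a proof plan for RH — Theorem 1.1 is Li's criterion
re-expressed; nothing here bears on the truth of RH.

## The argument

The printed proof of (3.8) (§3.3–3.4) expands `G_n` in the orthonormal basis
`F_γ = √(m_γ/π)·i(1+Θ(z))/(2(z−γ))` of the model space `𝒦(Θ)` (Prop. 3.2, from de Branges'
Theorem 22, [Re02] and the Clark-measure unitarity of [MaPo05]). Completeness of the family is not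
needed for (3.8): we prove the ORTHOGONALITY RELATIONS
`⟨f_γ, f_γ′⟩_{L²(ℝ)} = (π/m_γ)δ_{γγ′}`, `f_γ(x) = i(1+Θ(x))/(2(x−γ))`, directly — under RH,
`E = E_ξ` is a Hermite–Biehler function ([La06] Thm. 1, the tree's
`Lagarias2006_thm1_onlyif_holds`), so `A/E = (1+Θ)/2` is holomorphic and bounded by `1` on `ℂ₊`,
and `f_γ(x)\overline{f_{γ′}(x)} = Re[A(x)/(E(x)(x−γ)(x−γ′))]`; the integral over `ℝ` of the
holomorphic function `A(z)/(E(z)(z−γ)(z−γ′))` vanishes by Cauchy's theorem in `ℂ₊` (rectangles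
and a boundary shift `ε → 0⁺`, the removable singularities at the zeros being controlled by
(2.9)), the diagonal term being computed from the residue `Θ′(γ)/2 = −i/m_γ` (printed in the
proof of Prop. 3.2). Then the pointwise expansion (3.6) (`Suzuki2023b_eq0225_1_holds`) of the
`L²` function `G_n` (Prop. 2.2) in the orthogonal family `{f_γ}` with square-summable
coefficients gives `‖G_n‖² = π Σ_γ m_γ |1−(1−1/(½−iγ))ⁿ|²` (Bessel–Parseval for an orthogonal
series converging pointwise a.e.), and (3.7) turns `|…|²` into the curly bracket of (3.8).

## References
* M. Suzuki, J. Number Theory 252 (2023) 177–194, Prop. 3.2, §3.4 (3.6)–(3.9). [Suzuki2023b]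
* J. C. Lagarias, in: Frontiers in number theory, physics, and geometry I (2006), Thm. 1. [Lagarias2006]
-/

noncomputable section

open Complex Filter Topology Set MeasureTheory intervalIntegral
open scoped ComplexConjugate

namespace Literature.NumberTheory.LFunctions

open ZetaZeros Literature.Analysis.DeBrangesSpaces

/-! ## A contour lemma: holomorphic functions on the closed upper half-plane with quadratic decay -/

/-- **Cauchy's theorem in the upper half-plane, real-line form**: if `F` is complex-differentiable
at every point of the closed upper half-plane, `‖F(z)‖ ≤ C/|z|²` there for `|z| ≥ R₀`, and `F` is
integrable on `ℝ`, then `∫_ℝ F(x) dx = 0` (rectangles `[−R,R] × [0,R]`, `R → ∞`). [folklore] -/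
private theorem integral_eq_zero_of_differentiable_upperHalfPlane {F : ℂ → ℂ} {C R₀ : ℝ}
    (hF : ∀ z : ℂ, 0 ≤ z.im → DifferentiableAt ℂ F z)
    (hdecay : ∀ z : ℂ, 0 ≤ z.im → R₀ ≤ ‖z‖ → ‖F z‖ ≤ C / ‖z‖ ^ 2)
    (hint : Integrable (fun x : ℝ ↦ F x)) :
    ∫ x : ℝ, F x = 0 := by
  -- `C ≥ 0`
  have hC : 0 ≤ C := by
    set z₀ : ℂ := ((|R₀| + 1 : ℝ) : ℂ) * I with hz₀
    have hpos : (0 : ℝ) < |R₀| + 1 := by positivity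
    have hnorm : ‖z₀‖ = |R₀| + 1 := by
      rw [hz₀, norm_mul, Complex.norm_I, mul_one, Complex.norm_real, Real.norm_eq_abs,
        abs_of_pos hpos]
    have him : 0 ≤ z₀.im := by simp [hz₀]; positivity
    have h := hdecay z₀ him (by rw [hnorm]; linarith [le_abs_self R₀])
    by_contra hC
    rw [not_le] at hC
    have : C / ‖z₀‖ ^ 2 < 0 := div_neg_of_neg_of_pos hC (by rw [hnorm]; positivity)
    linarith [norm_nonneg (F z₀)]
  have hlim : Tendsto (fun R : ℝ ↦ ∫ x in -R..R, F x) atTop (𝓝 (∫ x : ℝ, F x)) :=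
    intervalIntegral_tendsto_integral hint tendsto_neg_atTop_atBot tendsto_id
  -- Cauchy on the rectangle `[-R, R] × [0, R]`
  have hrect : ∀ R : ℝ, 0 < R → ∫ x in -R..R, F x =
      (∫ x in -R..R, F (x + R * I)) - I • (∫ y in (0 : ℝ)..R, F (R + y * I)) +
        I • (∫ y in (0 : ℝ)..R, F (-R + y * I)) := by
    intro R hR
    have h := Complex.integral_boundary_rect_eq_zero_of_differentiableOn F (-R) (R + R * I) ?_
    · simp only [Complex.neg_re, Complex.ofReal_re, Complex.neg_im, Complex.ofReal_im, neg_zero,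
        Complex.ofReal_zero, zero_mul, add_zero, Complex.add_re, Complex.mul_re, Complex.I_re,
        mul_zero, Complex.I_im, mul_one, sub_self, Complex.add_im, Complex.mul_im, zero_add,
        Complex.ofReal_neg] at h
      linear_combination h
    · intro p hp
      refine (hF p ?_).differentiableWithinAt
      have h2 := (Complex.mem_reProdIm.1 hp).2
      simp only [Complex.neg_im, Complex.ofReal_im, neg_zero, Complex.add_im, Complex.mul_im,
        Complex.ofReal_re, Complex.I_im, mul_one, Complex.I_re, mul_zero, add_zero, zero_add] at h2
      rw [Set.uIcc_of_le hR.le] at h2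
      exact h2.1
  -- bounds on the three other sides
  have hbound : ∀ R : ℝ, max R₀ 1 ≤ R → ‖∫ x in -R..R, F x‖ ≤ 4 * C / R := by
    intro R hR
    have hR0 : R₀ ≤ R := le_trans (le_max_left _ _) hR
    have hR1 : 1 ≤ R := le_trans (le_max_right _ _) hR
    have hRpos : 0 < R := by linarith
    have hside : ∀ z : ℂ, 0 ≤ z.im → R ≤ ‖z‖ → ‖F z‖ ≤ C / R ^ 2 := fun z hz hzR ↦
      (hdecay z hz (hR0.trans hzR)).trans
        (div_le_div_of_nonneg_left hC (by positivity) (pow_le_pow_left₀ hRpos.le hzR 2))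
    have htop : ‖∫ x in -R..R, F (x + R * I)‖ ≤ C / R ^ 2 * |R - -R| := by
      refine intervalIntegral.norm_integral_le_of_norm_le_const fun x _ ↦ hside _ ?_ ?_
      · simp [hRpos.le]
      · have := Complex.abs_im_le_norm (x + R * I)
        simp only [Complex.add_im, Complex.ofReal_im, Complex.mul_im, Complex.ofReal_re,
          Complex.I_im, mul_one, Complex.I_re, mul_zero, add_zero, zero_add] at this
        rwa [abs_of_pos hRpos] at this
    have hright : ‖∫ y in (0 : ℝ)..R, F (R + y * I)‖ ≤ C / R ^ 2 * |R - 0| := by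
      refine intervalIntegral.norm_integral_le_of_norm_le_const fun y hy ↦ hside _ ?_ ?_
      · rw [Set.uIoc_of_le hRpos.le] at hy
        simp [hy.1.le]
      · have := Complex.abs_re_le_norm (R + y * I)
        simp only [Complex.add_re, Complex.ofReal_re, Complex.mul_re, Complex.I_re, mul_zero,
          Complex.ofReal_im, Complex.I_im, mul_one, sub_self, add_zero] at this
        rwa [abs_of_pos hRpos] at this
    have hleft : ‖∫ y in (0 : ℝ)..R, F (-R + y * I)‖ ≤ C / R ^ 2 * |R - 0| := by
      refine intervalIntegral.norm_integral_le_of_norm_le_const fun y hy ↦ hside _ ?_ ?_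
      · rw [Set.uIoc_of_le hRpos.le] at hy
        simp [hy.1.le]
      · have := Complex.abs_re_le_norm (-R + y * I)
        simp only [Complex.add_re, Complex.neg_re, Complex.ofReal_re, Complex.mul_re,
          Complex.I_re, mul_zero, Complex.ofReal_im, Complex.I_im, mul_one, sub_self,
          add_zero, abs_neg] at this
        rwa [abs_of_pos hRpos] at this
    rw [hrect R hRpos]
    have hI : ∀ v : ℂ, ‖I • v‖ = ‖v‖ := fun v ↦ by rw [norm_smul, Complex.norm_I, one_mul]
    calc ‖(∫ x in -R..R, F (x + R * I)) - I • (∫ y in (0 : ℝ)..R, F (R + y * I)) +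
          I • (∫ y in (0 : ℝ)..R, F (-R + y * I))‖
        ≤ ‖∫ x in -R..R, F (x + R * I)‖ + ‖I • (∫ y in (0 : ℝ)..R, F (R + y * I))‖ +
          ‖I • (∫ y in (0 : ℝ)..R, F (-R + y * I))‖ :=
          (norm_add_le _ _).trans (add_le_add (norm_sub_le _ _) le_rfl)
      _ ≤ C / R ^ 2 * |R - -R| + C / R ^ 2 * |R - 0| + C / R ^ 2 * |R - 0| := by
          rw [hI, hI]; exact add_le_add (add_le_add htop hright) hleft
      _ = 4 * C / R := by
          rw [sub_neg_eq_add, sub_zero, abs_of_pos (by linarith), abs_of_pos hRpos]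
          field_simp
          ring
  have hlim0 : Tendsto (fun R : ℝ ↦ ∫ x in -R..R, F x) atTop (𝓝 0) := by
    refine squeeze_zero_norm' (a := fun R ↦ 4 * C / R) ?_ ?_
    · filter_upwards [eventually_ge_atTop (max R₀ 1)] with R hR
      exact hbound R hR
    · exact tendsto_const_nhds.div_atTop tendsto_id
  exact tendsto_nhds_unique hlim hlim0

/-! ## Local germs of `ξ/((ξ+ξ′)(s−ρ))` at the zeros (RH-free) -/

/-- `ξ` is not locally zero anywhere (`ξ(0) = ½`). [folklore] -/
private theorem analyticOrderAt_riemannXi_ne_top' (ρ : ℂ) : analyticOrderAt riemannXi ρ ≠ ⊤ := by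
  intro htop
  have h0 : ∀ᶠ z in 𝓝 ρ, riemannXi z = 0 := analyticOrderAt_eq_top.mp htop
  have hall : AnalyticOnNhd ℂ riemannXi Set.univ := fun z _ ↦ differentiable_riemannXi.analyticAt z
  have := hall.eqOn_zero_of_preconnected_of_eventuallyEq_zero isPreconnected_univ (Set.mem_univ ρ)
    h0 (Set.mem_univ 0)
  rw [Pi.zero_apply, riemannXi_zero] at this
  norm_num at this

/-- **The analytic germ of `ξ(s)/((ξ(s)+ξ′(s))(s−ρ))` at a zero** (the content of eq. (2.9)
`ξ/(ξ+ξ′) = (s−ρ)(1/m_ρ + o(1))` in analytic form): there is a function `Q`, analytic at `ρ`, with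
`Q(ρ) = 1/m_ρ`, agreeing with `ξ/((ξ+ξ′)(s−ρ))` on a punctured neighbourhood of `ρ` (from
`ξ = (s−ρ)^m g`, `g(ρ) ≠ 0`: `Q = g/(m g + (s−ρ)(g+g′))`). RH-FREE.
[cite: Suzuki2023b, eq. (2.9), p. 6 L26–36] -/
theorem exists_analyticAt_xi_div_germ {ρ : ℂ} (hρ : ρ ∈ riemannZetaNontrivialZeros) :
    ∃ Q : ℂ → ℂ, AnalyticAt ℂ Q ρ ∧ Q ρ = 1 / (riemannZetaZeroOrder ρ : ℂ) ∧
      Q =ᶠ[𝓝[≠] ρ] fun s ↦ riemannXi s / ((riemannXi s + deriv riemannXi s) * (s - ρ)) := by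
  have hξa : AnalyticAt ℂ riemannXi ρ := differentiable_riemannXi.analyticAt ρ
  obtain ⟨m, hmdef⟩ : ∃ m : ℕ, analyticOrderNatAt riemannXi ρ = m := ⟨_, rfl⟩
  have hmZ : ((m : ℕ) : ℤ) = riemannZetaZeroOrder ρ := by
    rw [← hmdef]; exact natCast_analyticOrderNatAt_riemannXi hρ
  have hm1 : 1 ≤ m := by
    have := riemannZetaNontrivialZeros.one_le_order hρ
    omega
  obtain ⟨g, hg, hg0, hfg⟩ :=
    (hξa.analyticOrderNatAt_eq_iff (analyticOrderAt_riemannXi_ne_top' ρ)).mp hmdef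
  obtain ⟨k, rfl⟩ : ∃ k, m = k + 1 := ⟨m - 1, by omega⟩
  have hfg' : riemannXi =ᶠ[𝓝 ρ] fun z ↦ (z - ρ) ^ (k + 1) * g z :=
    hfg.mono fun z hz ↦ by rw [hz, smul_eq_mul]
  have hderiv : ∀ᶠ z in 𝓝 ρ, deriv riemannXi z =
      (k + 1) * (z - ρ) ^ k * g z + (z - ρ) ^ (k + 1) * deriv g z := by
    filter_upwards [hfg'.deriv, hg.eventually_analyticAt] with z hz hgz
    have hd1 : HasDerivAt (fun w : ℂ ↦ (w - ρ) ^ (k + 1)) ((k + 1) * (z - ρ) ^ k) z := by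
      have h := (hasDerivAt_pow (k + 1) (z - ρ)).comp z ((hasDerivAt_id z).sub_const ρ)
      simpa [Function.comp_def] using h
    rw [hz, deriv_fun_mul hd1.differentiableAt hgz.differentiableAt, hd1.deriv]
  have hEq : (fun s ↦ g s / ((k + 1) * g s + (s - ρ) * (g s + deriv g s))) =ᶠ[𝓝[≠] ρ]
      fun s ↦ riemannXi s / ((riemannXi s + deriv riemannXi s) * (s - ρ)) := by
    filter_upwards [hfg'.filter_mono nhdsWithin_le_nhds, hderiv.filter_mono nhdsWithin_le_nhds,
      self_mem_nhdsWithin] with z hz hdz hne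
    rw [hz, hdz]
    have hzρ : (z - ρ) ^ (k + 1) ≠ 0 := pow_ne_zero _ (sub_ne_zero.2 hne)
    have : ((z - ρ) ^ (k + 1) * g z + ((k + 1) * (z - ρ) ^ k * g z +
        (z - ρ) ^ (k + 1) * deriv g z)) * (z - ρ) =
        (z - ρ) ^ (k + 1) * ((k + 1) * g z + (z - ρ) * (g z + deriv g z)) := by ring
    rw [this, mul_div_mul_left _ _ hzρ]
  have hk1 : ((k : ℂ) + 1) ≠ 0 := by exact_mod_cast Nat.succ_ne_zero k
  refine ⟨_, ?_, ?_, hEq⟩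
  · refine hg.div ((analyticAt_const.mul hg).add
      ((analyticAt_id.sub analyticAt_const).mul (hg.add hg.deriv))) ?_
    simp only [sub_self, zero_mul, add_zero]
    exact mul_ne_zero hk1 hg0
  · simp only [sub_self, zero_mul, add_zero]
    rw [← hmZ]
    push_cast
    field_simp

/-- The upper-half-plane form of the germ: with `γ = i(ρ − ½)` (so `½ − iγ = ρ`), there is `q`
analytic at `γ` with `q(γ) = −i/m_ρ` and `q(z) = A(z)/(E(z)(z−γ))` on a punctured neighbourhood
of `γ` (`A(z) = ξ(½−iz)`, `E = E_ξ`; this is `Θ′(γ)/2 = lim (1+Θ(z))/(2(z−γ)) = −i/m_γ`, printed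
in the proof of Prop. 3.2). RH-FREE. [cite: Suzuki2023b, Prop. 3.2 (proof), p. 8 L40–44] -/
theorem exists_analyticAt_A_div_E_germ {ρ : ℂ} (hρ : ρ ∈ riemannZetaNontrivialZeros) :
    ∃ q : ℂ → ℂ, AnalyticAt ℂ q (suzukiZeroParam ρ) ∧
      q (suzukiZeroParam ρ) = -I / (riemannZetaZeroOrder ρ : ℂ) ∧
      q =ᶠ[𝓝[≠] (suzukiZeroParam ρ)]
        fun z ↦ lagariasXiA z / (lagariasE z * (z - suzukiZeroParam ρ)) := by
  obtain ⟨Q, hQ, hQρ, hQev⟩ := exists_analyticAt_xi_div_germ hρ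
  set γ := suzukiZeroParam ρ with hγ
  have haff : AnalyticAt ℂ (fun z : ℂ ↦ (1 / 2 : ℂ) - I * z) γ :=
    analyticAt_const.sub (analyticAt_const.mul analyticAt_id)
  have haffγ : (1 / 2 : ℂ) - I * γ = ρ := one_half_sub_I_mul_suzukiZeroParam ρ
  refine ⟨fun z ↦ -I * Q (1 / 2 - I * z), analyticAt_const.mul (hQ.comp_of_eq haff haffγ),
    by show -I * Q (1 / 2 - I * γ) = _; rw [haffγ, hQρ]; ring, ?_⟩
  -- push the punctured neighbourhood forward along `z ↦ ½ − iz`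
  have hT : Tendsto (fun z : ℂ ↦ (1 / 2 : ℂ) - I * z) (𝓝[≠] γ) (𝓝[≠] ρ) := by
    refine tendsto_nhdsWithin_of_tendsto_nhds_of_eventually_within _ ?_ ?_
    · have := haff.continuousAt.tendsto
      rw [haffγ] at this
      exact this.mono_left nhdsWithin_le_nhds
    · filter_upwards [self_mem_nhdsWithin] with z hz
      intro h
      apply hz
      have h' : (1 / 2 : ℂ) - I * z = 1 / 2 - I * γ := by rw [haffγ]; exact h
      have := mul_left_cancel₀ Complex.I_ne_zero (sub_right_injective h')
      exact this
  filter_upwards [hT.eventually hQev] with z hz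
  have hsub : (1 / 2 : ℂ) - I * z - ρ = -I * (z - γ) := by
    rw [← haffγ]; ring
  show -I * Q (1 / 2 - I * z) = _
  rw [hz, lagariasXiA_eq, hsub]
  simp only [lagariasE]
  have hI : -I ≠ 0 := neg_ne_zero.2 Complex.I_ne_zero
  by_cases hzγ : z - γ = 0
  · simp [hzγ]
  by_cases hE0 : riemannXi (1 / 2 - I * z) + deriv riemannXi (1 / 2 - I * z) = 0
  · rw [hE0]; simp
  field_simp

/-! ## Consequences of RH: `E` is Hermite–Biehler, the parameters `γ` are real -/

/-- Under RH, `E(z) ≠ 0` on the open upper half-plane ([La06] Thm. 1 ⟹ Hermite–Biehler).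
RH-CONSEQUENCE. [cite: Suzuki2023b, Prop. 3.1 (1)⇒(2), p. 7 L95–111] -/
theorem lagariasE_ne_zero_of_im_pos (hRH : RiemannHypothesis) {z : ℂ} (hz : 0 < z.im) :
    lagariasE z ≠ 0 :=
  (Lagarias2006_thm1_onlyif_holds hRH).ne_zero_of_im_pos hz

/-- Under RH, `|A(z)| ≤ |E(z)|` on the open upper half-plane (`A = (E + E♯)/2`, `|E♯| < |E|`),
i.e. `|(1+Θ)/2| ≤ 1`. RH-CONSEQUENCE. [cite: Suzuki2023b, §3.1–3.2, p. 7 L78–80, L95–111] -/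
theorem norm_lagariasXiA_le_norm_lagariasE (hRH : RiemannHypothesis) {z : ℂ} (hz : 0 < z.im) :
    ‖lagariasXiA z‖ ≤ ‖lagariasE z‖ := by
  have h := (Lagarias2006_thm1_onlyif_holds hRH).norm_sharp_lt hz
  unfold lagariasXiA
  rw [norm_div, Complex.norm_two]
  have := norm_add_le (lagariasE z) (sharp lagariasE z)
  linarith

/-- Under RH every `γ = i(ρ − ½)`, `ρ ∈ 𝒵`, is real. RH-CONSEQUENCE.
[cite: Suzuki2023b, Prop. 3.2 ("Γ ⊂ ℝ"), p. 8 L8–10] -/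
theorem suzukiZeroParam_im_eq_zero (hRH : RiemannHypothesis) {ρ : ℂ}
    (hρ : ρ ∈ riemannZetaNontrivialZeros) : (suzukiZeroParam ρ).im = 0 := by
  have hre : ρ.re = 1 / 2 := by
    refine hRH ρ (riemannZetaNontrivialZeros.zeta_eq_zero hρ) ?_
      (riemannZetaNontrivialZeros.ne_one hρ)
    rintro ⟨n, hn⟩
    have := riemannZetaNontrivialZeros.re_pos hρ
    rw [hn] at this
    simp at this
    linarith [(n.cast_nonneg : (0 : ℝ) ≤ n)]
  simp [suzukiZeroParam, hre]

/-- Under RH, `γ_ρ = (Re γ_ρ : ℝ)` as a complex number. RH-CONSEQUENCE.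
[cite: Suzuki2023b, Prop. 3.2 ("Γ ⊂ ℝ"), p. 8 L8–10] -/
theorem suzukiZeroParam_eq_ofReal (hRH : RiemannHypothesis) {ρ : ℂ}
    (hρ : ρ ∈ riemannZetaNontrivialZeros) :
    suzukiZeroParam ρ = ((suzukiZeroParam ρ).re : ℂ) :=
  Complex.ext (by simp) (by rw [suzukiZeroParam_im_eq_zero hRH hρ, Complex.ofReal_im])

/-! ## The integrand on the real line (RH-free identities) -/

/-- For real `x`, `conj E(x) = E♯(x) = 2A(x) − E(x)`. [folklore] -/
private theorem conj_lagariasE_ofReal (x : ℝ) :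
    conj (lagariasE x) = 2 * lagariasXiA x - lagariasE x := by
  have h : sharp lagariasE (x : ℂ) = conj (lagariasE x) := by
    rw [sharp_apply, Complex.conj_ofReal]
  rw [lagariasXiA, ← h]
  ring

/-- For real `x`, `A(x) = ξ(½ − ix)` is real. [folklore] -/
private theorem conj_lagariasXiA_ofReal (x : ℝ) : conj (lagariasXiA x) = lagariasXiA x := by
  rw [← lagariasXiA_conj, Complex.conj_ofReal]

/-- On the real line `Re(A/E) = |A/E|²` (`A` real, `E = A + iC` with `C` real), valid also at the
zeros of `E` (both sides `0`). [cite: Suzuki2023b, Prop. 2.2 (proof), p. 6 L52–60] -/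
theorem re_lagariasXiA_div_lagariasE_ofReal (x : ℝ) :
    (lagariasXiA x / lagariasE x).re = Complex.normSq (lagariasXiA x / lagariasE x) := by
  by_cases hE : lagariasE x = 0
  · simp [hE]
  set a := lagariasXiA (x : ℂ) with ha
  set e := lagariasE (x : ℂ) with he
  have hca : conj a = a := conj_lagariasXiA_ofReal x
  have hce : conj e = 2 * a - e := conj_lagariasE_ofReal x
  have hce0 : 2 * a - e ≠ 0 := by rw [← hce]; exact (map_ne_zero _).2 hE
  have h1 : ((a / e).re : ℂ) = (a / e + conj (a / e)) / 2 := Complex.re_eq_add_conj _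
  have h2 : (Complex.normSq (a / e) : ℂ) = a / e * conj (a / e) := (Complex.mul_conj _).symm
  have hce0' : a * 2 - e ≠ 0 := by rwa [mul_comm] at hce0
  apply Complex.ofReal_injective
  rw [h1, h2, map_div₀, hca, hce]
  field_simp
  ring

/-- The product of two terms of (3.6) on the real line: for real `x, γ, γ′` with `E(x) ≠ 0`,
`[i(1+Θ(x))/(2(x−γ))]·conj[i(1+Θ(x))/(2(x−γ′))] = |A(x)/E(x)|²/((x−γ)(x−γ′))
 = Re[A(x)/(E(x)(x−γ)(x−γ′))]`. RH-FREE. [cite: Suzuki2023b, §3.4 (3.6), p. 8 L85–96] -/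
theorem suzukiTerm_mul_conj_ofReal {x : ℝ} (γ γ' : ℝ) (hE : lagariasE x ≠ 0) :
    I * (1 + lagariasTheta x) / (2 * ((x : ℂ) - γ)) *
        conj (I * (1 + lagariasTheta x) / (2 * ((x : ℂ) - γ'))) =
      ((lagariasXiA x / (lagariasE x * ((x : ℂ) - γ) * ((x : ℂ) - γ'))).re : ℂ) := by
  have hΘ : 1 + lagariasTheta x = 2 * (lagariasXiA x / lagariasE x) := by
    rw [lagariasTheta, lagariasXiA]
    field_simp
  have hre : (lagariasXiA x / (lagariasE x * ((x : ℂ) - γ) * ((x : ℂ) - γ'))).re =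
      Complex.normSq (lagariasXiA x / lagariasE x) * ((x - γ) * (x - γ'))⁻¹ := by
    have : lagariasXiA x / (lagariasE x * ((x : ℂ) - γ) * ((x : ℂ) - γ')) =
        (lagariasXiA x / lagariasE x) * ((((x - γ) * (x - γ'))⁻¹ : ℝ) : ℂ) := by
      push_cast
      rw [mul_assoc, ← div_div, div_eq_mul_inv]
    rw [this, Complex.re_mul_ofReal, re_lagariasXiA_div_lagariasE_ofReal]
  rw [hre, hΘ]
  have h2 : (Complex.normSq (lagariasXiA x / lagariasE x) : ℂ) =
      lagariasXiA x / lagariasE x * conj (lagariasXiA x / lagariasE x) := (Complex.mul_conj _).symm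
  have hcE : conj (lagariasE x) ≠ 0 := (map_ne_zero _).2 hE
  push_cast
  rw [h2]
  simp only [map_mul, map_div₀, Complex.conj_I, map_ofNat, map_sub, Complex.conj_ofReal]
  by_cases h1 : ((x : ℂ) - γ) = 0
  · simp [h1]
  by_cases h2' : ((x : ℂ) - γ') = 0
  · simp [h2']
  field_simp
  ring_nf
  rw [Complex.I_sq]
  ring

/-! ## Orthogonality of the functions `i(1+Θ(x))/(2(x−γ))`: the off-diagonal relations -/

/-- Local boundedness of `A(z)/(E(z)(z−γ))` on a punctured disc about `γ = γ_ρ` (from the germ).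
RH-FREE. [cite: Suzuki2023b, Prop. 3.2 (proof), p. 8 L40–44] -/
theorem exists_bound_A_div_E_near {ρ : ℂ} (hρ : ρ ∈ riemannZetaNontrivialZeros) :
    ∃ δ > 0, ∃ M : ℝ, 0 ≤ M ∧ ∀ w : ℂ, w ≠ suzukiZeroParam ρ → dist w (suzukiZeroParam ρ) < δ →
      ‖lagariasXiA w / (lagariasE w * (w - suzukiZeroParam ρ))‖ ≤ M := by
  obtain ⟨q, hq, -, hqev⟩ := exists_analyticAt_A_div_E_germ hρ
  set γ := suzukiZeroParam ρ
  have hbd : ∀ᶠ w in 𝓝 γ, ‖q w‖ < ‖q γ‖ + 1 :=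
    hq.continuousAt.norm.eventually_lt_const (lt_add_one _)
  have hev : ∀ᶠ w in 𝓝 γ, w ≠ γ → q w = lagariasXiA w / (lagariasE w * (w - γ)) :=
    eventually_nhdsWithin_iff.1 hqev
  obtain ⟨δ, hδ, hball⟩ := Metric.eventually_nhds_iff_ball.1 (hbd.and hev)
  refine ⟨δ, hδ, ‖q γ‖ + 1, by positivity, fun w hw hdist ↦ ?_⟩
  obtain ⟨h1, h2⟩ := hball w hdist
  rw [← h2 hw]
  exact h1.le

/-- Under RH, `|A(w)/E(w)| ≤ 1` on the closed upper half-plane (`|E♯| < |E|` inside; on the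
real line `|ξ| ≤ |ξ + ξ′|`, `norm_riemannXi_le_norm_add_deriv_critical`; at a real zero of `E`
the Lean quotient is `0`). RH-CONSEQUENCE (the interior case).
[cite: Suzuki2023b, §3.2, p. 7 L78–80; Prop. 2.2 (proof), p. 6 L52–60] -/
theorem norm_lagariasXiA_div_lagariasE_le_one (hRH : RiemannHypothesis) {w : ℂ} (hw : 0 ≤ w.im) :
    ‖lagariasXiA w / lagariasE w‖ ≤ 1 := by
  by_cases hE : lagariasE w = 0
  · simp [hE]
  rw [norm_div, div_le_one (norm_pos_iff.2 hE)]
  rcases hw.lt_or_eq with hlt | heq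
  · exact norm_lagariasXiA_le_norm_lagariasE hRH hlt
  · have hwr : w = ((w.re : ℝ) : ℂ) := Complex.ext (by simp) (by simp [← heq])
    rw [hwr, lagariasXiA_eq]
    exact (norm_riemannXi_le_norm_add_deriv_critical w.re).1

/-- Under RH, `|A(w)/(E(w)(w−a)(w−b))| ≤ 1/(|w−a||w−b|)` on the closed upper half-plane.
RH-CONSEQUENCE. [cite: Suzuki2023b, §3.2, p. 7 L78–80] -/
theorem norm_lagariasKernel_le (hRH : RiemannHypothesis) {w : ℂ} (hw : 0 ≤ w.im) (a b : ℂ) :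
    ‖lagariasXiA w / (lagariasE w * (w - a) * (w - b))‖ ≤ 1 / (‖w - a‖ * ‖w - b‖) := by
  have h := norm_lagariasXiA_div_lagariasE_le_one hRH hw
  rw [mul_assoc, ← div_div, norm_div, norm_mul]
  exact div_le_div_of_nonneg_right h (by positivity)

/-- The boundary shift: if `Ψ` is holomorphic on the open upper half-plane with
`|Ψ(z)| ≤ K/|z|²` there for `|z| ≥ R₀`, and `x ↦ Ψ(x + iε)` is integrable (`ε > 0`), then
`∫_ℝ Ψ(x + iε) dx = 0`. [folklore] -/
private theorem integral_shift_eq_zero {Ψ : ℂ → ℂ} {K R₀ ε : ℝ} (hε : 0 < ε)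
    (hΨ : ∀ z : ℂ, 0 < z.im → DifferentiableAt ℂ Ψ z)
    (hdecay : ∀ z : ℂ, 0 < z.im → R₀ ≤ ‖z‖ → ‖Ψ z‖ ≤ K / ‖z‖ ^ 2)
    (hint : Integrable (fun x : ℝ ↦ Ψ (x + ε * I))) :
    ∫ x : ℝ, Ψ (x + ε * I) = 0 := by
  -- `K ≥ 0`
  have hK : 0 ≤ K := by
    set z₀ : ℂ := ((|R₀| + 1 : ℝ) : ℂ) * I with hz₀
    have hpos : (0 : ℝ) < |R₀| + 1 := by positivity
    have hnorm : ‖z₀‖ = |R₀| + 1 := by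
      rw [hz₀, norm_mul, Complex.norm_I, mul_one, Complex.norm_real, Real.norm_eq_abs,
        abs_of_pos hpos]
    have him : 0 < z₀.im := by simp [hz₀]; positivity
    have h := hdecay z₀ him (by rw [hnorm]; linarith [le_abs_self R₀])
    by_contra hK
    rw [not_le] at hK
    have : K / ‖z₀‖ ^ 2 < 0 := div_neg_of_neg_of_pos hK (by rw [hnorm]; positivity)
    linarith [norm_nonneg (Ψ z₀)]
  have him : ∀ z : ℂ, 0 ≤ z.im → 0 < (z + ε * I).im := fun z hz ↦ by
    simp; linarith
  refine integral_eq_zero_of_differentiable_upperHalfPlane (F := fun z ↦ Ψ (z + ε * I))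
    (C := 4 * K) (R₀ := max (|R₀| + ε) (2 * ε)) (fun z hz ↦ ?_) (fun z hz hzR ↦ ?_) hint
  · exact (hΨ _ (him z hz)).comp z (differentiableAt_id.add_const _)
  · have h1 : ‖z‖ - ε ≤ ‖z + ε * I‖ := by
      have : ‖z‖ ≤ ‖z + ε * I‖ + ‖(ε : ℂ) * I‖ := by
        calc ‖z‖ = ‖(z + ε * I) - ε * I‖ := by ring_nf
          _ ≤ ‖z + ε * I‖ + ‖(ε : ℂ) * I‖ := norm_sub_le _ _
      have hn : ‖(ε : ℂ) * I‖ = ε := by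
        rw [norm_mul, Complex.norm_I, mul_one, Complex.norm_real, Real.norm_eq_abs, abs_of_pos hε]
      linarith
    have hR1 : |R₀| + ε ≤ ‖z‖ := le_trans (le_max_left _ _) hzR
    have hR2 : 2 * ε ≤ ‖z‖ := le_trans (le_max_right _ _) hzR
    have hzpos : 0 < ‖z‖ := by linarith
    have h2 : ‖z‖ / 2 ≤ ‖z + ε * I‖ := by linarith
    have hwpos : 0 < ‖z + ε * I‖ := by linarith
    calc ‖Ψ (z + ε * I)‖ ≤ K / ‖z + ε * I‖ ^ 2 :=
          hdecay _ (him z hz) (by linarith [le_abs_self R₀])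
      _ ≤ K / (‖z‖ / 2) ^ 2 :=
          div_le_div_of_nonneg_left hK (by positivity) (pow_le_pow_left₀ (by positivity) h2 2)
      _ = 4 * K / ‖z‖ ^ 2 := by
          field_simp
          ring

/-- Two elementary majorants. [folklore] -/
private theorem inv_mul_le_half (a b : ℝ) (ha : 0 < a) (hb : 0 < b) :
    1 / (a * b) ≤ (1 / a ^ 2 + 1 / b ^ 2) / 2 := by
  rw [div_add_div _ _ (by positivity) (by positivity), div_div,
    div_le_div_iff₀ (by positivity) (by positivity)]
  nlinarith [sq_nonneg (a - b), mul_pos ha hb]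

/-- `1/u² ≤ (1 + 1/c²)(1+u²)⁻¹` for `|u| ≥ c > 0`. [folklore] -/
private theorem inv_sq_le_inv_one_add_sq {u c : ℝ} (hc : 0 < c) (hu : c ≤ |u|) :
    1 / u ^ 2 ≤ (1 + 1 / c ^ 2) * (1 + u ^ 2)⁻¹ := by
  have hu0 : 0 < u ^ 2 := by
    have : 0 < |u| := lt_of_lt_of_le hc hu
    rw [← sq_abs]
    exact pow_pos this 2
  have hcu : c ^ 2 ≤ u ^ 2 := by
    calc c ^ 2 ≤ |u| ^ 2 := pow_le_pow_left₀ hc.le hu 2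
      _ = u ^ 2 := sq_abs u
  rw [← div_eq_mul_inv, div_le_div_iff₀ hu0 (by positivity)]
  have : 1 / c ^ 2 * u ^ 2 ≥ 1 := by
    rw [ge_iff_le, one_div, inv_mul_eq_div, le_div_iff₀ (by positivity)]
    linarith
  nlinarith

/-- `B ≤ B(1+c²)(1+u²)⁻¹` for `|u| < c`, `B ≥ 0`. [folklore] -/
private theorem const_le_inv_one_add_sq {u c B : ℝ} (hB : 0 ≤ B) (hu : |u| < c) :
    B ≤ B * (1 + c ^ 2) * (1 + u ^ 2)⁻¹ := by
  have hu2 : u ^ 2 < c ^ 2 := by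
    calc u ^ 2 = |u| ^ 2 := (sq_abs u).symm
      _ < c ^ 2 := pow_lt_pow_left₀ hu (abs_nonneg u) two_ne_zero
  rw [mul_assoc, ← div_eq_mul_inv]
  have : 1 ≤ (1 + c ^ 2) / (1 + u ^ 2) := by
    rw [le_div_iff₀ (by positivity)]
    linarith
  nlinarith

/-- `x ↦ (1 + (x − a)²)⁻¹` is integrable. [folklore] -/
private theorem integrable_inv_one_add_sq_sub (a : ℝ) :
    Integrable fun x : ℝ ↦ (1 + (x - a) ^ 2)⁻¹ :=
  integrable_inv_one_add_sq.comp_sub_right a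

/-- The set of real `x` at which `ξ(½ − ix) = 0` is countable (ordinates of critical zeros), hence
Lebesgue-null; it contains the real zeros of `E`. [folklore] -/
private theorem countable_critical_zero_ordinates :
    {x : ℝ | riemannXi (1 / 2 - I * x) = 0}.Countable := by
  have hinj : Function.Injective fun x : ℝ ↦ (1 / 2 : ℂ) - I * x := by
    intro a b h
    have := congrArg Complex.im h
    simpa using this
  have : {x : ℝ | riemannXi (1 / 2 - I * x) = 0} =
      (fun x : ℝ ↦ (1 / 2 : ℂ) - I * x) ⁻¹' riemannZetaNontrivialZeros := by
    ext x
    simp only [Set.mem_setOf_eq, Set.mem_preimage]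
    constructor
    · intro h
      by_contra hx
      exact (riemannXi_ne_zero_iff_not_mem _).2 hx h
    · intro h
      by_contra hx
      exact (riemannXi_ne_zero_iff_not_mem _).1 hx h
  rw [this]
  exact riemannZetaNontrivialZeros_countable.preimage hinj

/-- **The off-diagonal orthogonality relation** (the heart of Prop. 3.2 as used in (3.8)): under
RH, for distinct zeros `ρ ≠ ρ′` with (real) parameters `γ, γ′`, the function
`x ↦ A(x)/(E(x)(x−γ)(x−γ′))` is integrable on `ℝ` and its integral vanishes — Cauchy's theorem
in the upper half-plane, where `A/E` is holomorphic and bounded by `1`, after the boundary shift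
`ε → 0⁺` (dominated convergence; near `γ, γ′` the integrand is controlled by the germs of
`A/(E(z−γ))`). Its real part is `⟨f_γ, f_{γ′}⟩_{L²}` (`suzukiTerm_mul_conj_ofReal`).
RH-CONSEQUENCE. [cite: Suzuki2023b, Prop. 3.2, p. 8 L6–44] -/
theorem integral_kernel_offDiag (hRH : RiemannHypothesis) {ρ ρ' : ℂ}
    (hρ : ρ ∈ riemannZetaNontrivialZeros) (hρ' : ρ' ∈ riemannZetaNontrivialZeros) (hne : ρ ≠ ρ') :
    Integrable (fun x : ℝ ↦ lagariasXiA x /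
        (lagariasE x * (x - suzukiZeroParam ρ) * (x - suzukiZeroParam ρ'))) ∧
      ∫ x : ℝ, lagariasXiA x /
        (lagariasE x * (x - suzukiZeroParam ρ) * (x - suzukiZeroParam ρ')) = 0 := by
  -- the real parameters
  set γc := suzukiZeroParam ρ with hγc
  set γc' := suzukiZeroParam ρ' with hγc'
  set γ : ℝ := γc.re with hγ
  set γ' : ℝ := γc'.re with hγ'
  have hγr : γc = (γ : ℂ) := suzukiZeroParam_eq_ofReal hRH hρ
  have hγr' : γc' = (γ' : ℂ) := suzukiZeroParam_eq_ofReal hRH hρ'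
  have hγne : γ ≠ γ' := by
    intro h
    apply hne
    have h2 : γc = γc' := by rw [hγr, hγr', h]
    have h3 := congrArg (fun w ↦ 1 / 2 - I * w) h2
    simpa only [hγc, hγc', one_half_sub_I_mul_suzukiZeroParam] using h3
  have hdpos : 0 < |γ - γ'| := abs_pos.2 (sub_ne_zero.2 hγne)
  set Φ : ℂ → ℂ := fun z ↦ lagariasXiA z / (lagariasE z * (z - γc) * (z - γc')) with hΦ
  -- local bounds near `γ` and `γ'`
  obtain ⟨δ₁, hδ₁, M₁, hM₁, hb₁⟩ := exists_bound_A_div_E_near hρ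
  obtain ⟨δ₂, hδ₂, M₂, hM₂, hb₂⟩ := exists_bound_A_div_E_near hρ'
  -- the radius of the windows
  set δ : ℝ := min (min δ₁ δ₂) (|γ - γ'| / 2) with hδdef
  have hδ : 0 < δ := by positivity
  have hδ1 : δ ≤ δ₁ := le_trans (min_le_left _ _) (min_le_left _ _)
  have hδ2 : δ ≤ δ₂ := le_trans (min_le_left _ _) (min_le_right _ _)
  have hδ3 : δ ≤ |γ - γ'| / 2 := min_le_right _ _
  -- the bound in the windows
  set B₁ : ℝ := M₁ * (2 / |γ - γ'|) with hB₁
  set B₂ : ℝ := M₂ * (2 / |γ - γ'|) with hB₂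
  have hB₁0 : 0 ≤ B₁ := by positivity
  have hB₂0 : 0 ≤ B₂ := by positivity
  -- the key pointwise estimate on the strip `0 ≤ ε < δ/2`
  have hkey : ∀ (x ε : ℝ), 0 ≤ ε → ε < δ / 2 → (x : ℂ) + ε * I ≠ γc → (x : ℂ) + ε * I ≠ γc' →
      ‖Φ (x + ε * I)‖ ≤ max (max (B₁ * (1 + (δ / 2) ^ 2)) (B₂ * (1 + (δ / 2) ^ 2)))
        ((1 + 1 / (δ / 2) ^ 2) / 2) * ((1 + (x - γ) ^ 2)⁻¹ + (1 + (x - γ') ^ 2)⁻¹) := by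
    intro x ε hε0 hεδ hw1 hw2
    set w : ℂ := x + ε * I with hw
    set L := max (max (B₁ * (1 + (δ / 2) ^ 2)) (B₂ * (1 + (δ / 2) ^ 2)))
      ((1 + 1 / (δ / 2) ^ 2) / 2) with hL
    have hL0 : 0 ≤ L := le_trans (by positivity) (le_max_right _ _)
    have hwim : 0 ≤ w.im := by simp [hw, hε0]
    have hre1 : (w - γc).re = x - γ := by simp [hw, hγr]
    have hre2 : (w - γc').re = x - γ' := by simp [hw, hγr']
    have hn1 : |x - γ| ≤ ‖w - γc‖ := by rw [← hre1]; exact Complex.abs_re_le_norm _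
    have hn2 : |x - γ'| ≤ ‖w - γc'‖ := by rw [← hre2]; exact Complex.abs_re_le_norm _
    have hd1 : ‖w - γc‖ ≤ |x - γ| + ε := by
      have : w - γc = ((x - γ : ℝ) : ℂ) + ε * I := by rw [hw, hγr]; push_cast; ring
      rw [this]
      calc ‖((x - γ : ℝ) : ℂ) + ε * I‖ ≤ ‖((x - γ : ℝ) : ℂ)‖ + ‖(ε : ℂ) * I‖ := norm_add_le _ _
        _ = |x - γ| + ε := by
          rw [Complex.norm_real, Real.norm_eq_abs, norm_mul, Complex.norm_I, mul_one,
            Complex.norm_real, Real.norm_eq_abs, abs_of_nonneg hε0]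
    have hd2 : ‖w - γc'‖ ≤ |x - γ'| + ε := by
      have : w - γc' = ((x - γ' : ℝ) : ℂ) + ε * I := by rw [hw, hγr']; push_cast; ring
      rw [this]
      calc ‖((x - γ' : ℝ) : ℂ) + ε * I‖ ≤ ‖((x - γ' : ℝ) : ℂ)‖ + ‖(ε : ℂ) * I‖ := norm_add_le _ _
        _ = |x - γ'| + ε := by
          rw [Complex.norm_real, Real.norm_eq_abs, norm_mul, Complex.norm_I, mul_one,
            Complex.norm_real, Real.norm_eq_abs, abs_of_nonneg hε0]
    have hpos1 : 0 < (1 + (x - γ) ^ 2)⁻¹ := by positivity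
    have hpos2 : 0 < (1 + (x - γ') ^ 2)⁻¹ := by positivity
    by_cases hx1 : |x - γ| < δ / 2
    · -- window about `γ`
      have hdist : dist w γc < δ₁ := by
        rw [dist_eq_norm]; linarith
      have hfar : |γ - γ'| / 2 ≤ ‖w - γc'‖ := by
        have : |γ - γ'| ≤ |x - γ| + |x - γ'| := by
          calc |γ - γ'| = |(x - γ') - (x - γ)| := by ring_nf
            _ ≤ |x - γ'| + |x - γ| := abs_sub _ _
            _ = |x - γ| + |x - γ'| := add_comm _ _
        linarith
      have hΦw : Φ w = lagariasXiA w / (lagariasE w * (w - γc)) / (w - γc') := by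
        simp only [hΦ]; rw [div_div]
      have h1 : ‖Φ w‖ ≤ B₁ := by
        rw [hΦw, norm_div]
        calc ‖lagariasXiA w / (lagariasE w * (w - γc))‖ / ‖w - γc'‖
            ≤ M₁ / (|γ - γ'| / 2) := by
              gcongr
              exact hb₁ w hw1 hdist
          _ = B₁ := by rw [hB₁]; field_simp
      calc ‖Φ w‖ ≤ B₁ := h1
        _ ≤ B₁ * (1 + (δ / 2) ^ 2) * (1 + (x - γ) ^ 2)⁻¹ := const_le_inv_one_add_sq hB₁0 hx1
        _ ≤ L * (1 + (x - γ) ^ 2)⁻¹ := by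
          gcongr
          exact le_trans (le_max_left _ _) (le_max_left _ _)
        _ ≤ L * ((1 + (x - γ) ^ 2)⁻¹ + (1 + (x - γ') ^ 2)⁻¹) := by
          gcongr; linarith
    by_cases hx2 : |x - γ'| < δ / 2
    · -- window about `γ'`
      have hdist : dist w γc' < δ₂ := by
        rw [dist_eq_norm]; linarith
      have hfar : |γ - γ'| / 2 ≤ ‖w - γc‖ := by
        have : |γ - γ'| ≤ |x - γ| + |x - γ'| := by
          calc |γ - γ'| = |(x - γ') - (x - γ)| := by ring_nf
            _ ≤ |x - γ'| + |x - γ| := abs_sub _ _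
            _ = |x - γ| + |x - γ'| := add_comm _ _
        linarith
      have hΦw : Φ w = lagariasXiA w / (lagariasE w * (w - γc')) / (w - γc) := by
        simp only [hΦ]; rw [div_div]; ring
      have h1 : ‖Φ w‖ ≤ B₂ := by
        rw [hΦw, norm_div]
        calc ‖lagariasXiA w / (lagariasE w * (w - γc'))‖ / ‖w - γc‖
            ≤ M₂ / (|γ - γ'| / 2) := by
              gcongr
              exact hb₂ w hw2 hdist
          _ = B₂ := by rw [hB₂]; field_simp
      calc ‖Φ w‖ ≤ B₂ := h1
        _ ≤ B₂ * (1 + (δ / 2) ^ 2) * (1 + (x - γ') ^ 2)⁻¹ := const_le_inv_one_add_sq hB₂0 hx2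
        _ ≤ L * (1 + (x - γ') ^ 2)⁻¹ := by
          gcongr
          exact le_trans (le_max_right _ _) (le_max_left _ _)
        _ ≤ L * ((1 + (x - γ) ^ 2)⁻¹ + (1 + (x - γ') ^ 2)⁻¹) := by
          gcongr; linarith
    -- outside both windows
    rw [not_lt] at hx1 hx2
    have ha : 0 < |x - γ| := lt_of_lt_of_le (by positivity) hx1
    have hb : 0 < |x - γ'| := lt_of_lt_of_le (by positivity) hx2
    calc ‖Φ w‖ ≤ 1 / (‖w - γc‖ * ‖w - γc'‖) := norm_lagariasKernel_le hRH hwim γc γc'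
      _ ≤ 1 / (|x - γ| * |x - γ'|) := by
          gcongr
      _ ≤ (1 / |x - γ| ^ 2 + 1 / |x - γ'| ^ 2) / 2 := inv_mul_le_half _ _ ha hb
      _ = (1 / (x - γ) ^ 2 + 1 / (x - γ') ^ 2) / 2 := by rw [sq_abs, sq_abs]
      _ ≤ ((1 + 1 / (δ / 2) ^ 2) * (1 + (x - γ) ^ 2)⁻¹ +
            (1 + 1 / (δ / 2) ^ 2) * (1 + (x - γ') ^ 2)⁻¹) / 2 := by
          gcongr
          · exact inv_sq_le_inv_one_add_sq (by positivity) hx1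
          · exact inv_sq_le_inv_one_add_sq (by positivity) hx2
      _ = (1 + 1 / (δ / 2) ^ 2) / 2 * ((1 + (x - γ) ^ 2)⁻¹ + (1 + (x - γ') ^ 2)⁻¹) := by ring
      _ ≤ L * ((1 + (x - γ) ^ 2)⁻¹ + (1 + (x - γ') ^ 2)⁻¹) := by
          gcongr
          exact le_max_right _ _
  -- the dominating function
  set L := max (max (B₁ * (1 + (δ / 2) ^ 2)) (B₂ * (1 + (δ / 2) ^ 2)))
    ((1 + 1 / (δ / 2) ^ 2) / 2) with hL
  set bound : ℝ → ℝ := fun x ↦ L * ((1 + (x - γ) ^ 2)⁻¹ + (1 + (x - γ') ^ 2)⁻¹) with hbound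
  have hbound_int : Integrable bound :=
    ((integrable_inv_one_add_sq_sub γ).add (integrable_inv_one_add_sq_sub γ')).const_mul L
  have hkey' : ∀ w : ℂ, 0 ≤ w.im → w.im < δ / 2 → w ≠ γc → w ≠ γc' → ‖Φ w‖ ≤ bound w.re := by
    intro w h1 h2 h3 h4
    have hw : ((w.re : ℝ) : ℂ) + (w.im : ℝ) * I = w := Complex.ext (by simp) (by simp)
    have := hkey w.re w.im h1 h2 (by rwa [hw]) (by rwa [hw])
    rwa [hw] at this
  -- regularity of `Φ`
  have hAd : Differentiable ℂ lagariasXiA := by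
    have : lagariasXiA = fun z ↦ riemannXi (1 / 2 - I * z) := funext lagariasXiA_eq
    rw [this]
    exact differentiable_riemannXi.comp
      ((differentiable_const _).sub ((differentiable_const _).mul differentiable_id))
  have hEd : Differentiable ℂ lagariasE := differentiable_lagariasE
  have hΦdiff : ∀ z : ℂ, lagariasE z ≠ 0 → z ≠ γc → z ≠ γc' → DifferentiableAt ℂ Φ z := by
    intro z hE h1 h2
    exact (hAd z).div (((hEd z).mul (differentiableAt_id.sub_const _)).mul
      (differentiableAt_id.sub_const _))
      (mul_ne_zero (mul_ne_zero hE (sub_ne_zero.2 h1)) (sub_ne_zero.2 h2))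
  have hΦm : Measurable Φ :=
    hAd.continuous.measurable.div ((hEd.continuous.measurable.mul
      (measurable_id.sub_const _)).mul (measurable_id.sub_const _))
  have hmeas : ∀ ε : ℝ, AEStronglyMeasurable (fun x : ℝ ↦ Φ (x + ε * I)) :=
    fun ε ↦ (hΦm.comp (Complex.continuous_ofReal.measurable.add_const _)).aestronglyMeasurable
  -- points of the open upper half-plane are never `γc`, `γc'`
  have hne_of_im : ∀ w : ℂ, 0 < w.im → w ≠ γc ∧ w ≠ γc' := by
    intro w hw
    constructor
    · intro h; rw [h, hγr, Complex.ofReal_im] at hw; exact lt_irrefl _ hw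
    · intro h; rw [h, hγr', Complex.ofReal_im] at hw; exact lt_irrefl _ hw
  -- (a) the shifted integrals vanish
  have hzero : ∀ ε : ℝ, 0 < ε → ε < δ / 2 → ∫ x : ℝ, Φ (x + ε * I) = 0 := by
    intro ε hε hεδ
    have himε : ∀ x : ℝ, ((x : ℂ) + ε * I).im = ε := fun x ↦ by simp
    refine integral_shift_eq_zero (K := 4) (R₀ := 2 * (‖γc‖ + ‖γc'‖)) hε
      (fun z hz ↦ hΦdiff z (lagariasE_ne_zero_of_im_pos hRH hz) (hne_of_im z hz).1
        (hne_of_im z hz).2) (fun z hz hzR ↦ ?_) ?_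
    · have h1 : ‖z‖ / 2 ≤ ‖z - γc‖ := by
        have := norm_sub_norm_le z γc
        linarith [norm_nonneg γc']
      have h2 : ‖z‖ / 2 ≤ ‖z - γc'‖ := by
        have := norm_sub_norm_le z γc'
        linarith [norm_nonneg γc]
      have hzpos : 0 < ‖z‖ := norm_pos_iff.2 (by
        intro h; rw [h, Complex.zero_im] at hz; exact lt_irrefl _ hz)
      calc ‖Φ z‖ ≤ 1 / (‖z - γc‖ * ‖z - γc'‖) := norm_lagariasKernel_le hRH hz.le γc γc'
        _ ≤ 1 / (‖z‖ / 2 * (‖z‖ / 2)) := by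
            apply div_le_div_of_nonneg_left zero_le_one (by positivity)
            exact mul_le_mul h1 h2 (by positivity) (norm_nonneg _)
        _ = 4 / ‖z‖ ^ 2 := by field_simp; ring
    · refine hbound_int.mono' (hmeas ε) (Filter.Eventually.of_forall fun x ↦ ?_)
      have h := hkey' (x + ε * I) (by rw [himε]; exact hε.le) (by rwa [himε])
        (hne_of_im _ (by rw [himε]; exact hε)).1 (hne_of_im _ (by rw [himε]; exact hε)).2
      simpa using h
  -- (b) dominated convergence as `ε → 0⁺`
  have h_bound : ∀ᶠ ε : ℝ in 𝓝[>] 0, ∀ᵐ x : ℝ, ‖Φ (x + ε * I)‖ ≤ bound x := by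
    filter_upwards [Ioo_mem_nhdsGT (show (0 : ℝ) < δ / 2 by positivity)] with ε hε
    refine Filter.Eventually.of_forall fun x ↦ ?_
    have himε : ((x : ℂ) + ε * I).im = ε := by simp
    have h := hkey' (x + ε * I) (by rw [himε]; exact hε.1.le) (by rw [himε]; exact hε.2)
      (hne_of_im _ (by rw [himε]; exact hε.1)).1 (hne_of_im _ (by rw [himε]; exact hε.1)).2
    simpa using h
  -- the exceptional set on the real line
  set N : Set ℝ := {x : ℝ | riemannXi (1 / 2 - I * x) = 0} ∪ {γ, γ'} with hN
  have hNc : N.Countable := countable_critical_zero_ordinates.union (Set.toFinite _).countable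
  have hgood : ∀ x : ℝ, x ∉ N → lagariasE x ≠ 0 ∧ (x : ℂ) ≠ γc ∧ (x : ℂ) ≠ γc' := by
    intro x hx
    simp only [hN, Set.mem_union, Set.mem_setOf_eq, Set.mem_insert_iff, Set.mem_singleton_iff,
      not_or] at hx
    refine ⟨fun h ↦ hx.1 ((lagariasE_ofReal_eq_zero_iff x).1 h).1, ?_, ?_⟩
    · rw [hγr]; exact_mod_cast hx.2.1
    · rw [hγr']; exact_mod_cast hx.2.2
  have h_lim : ∀ᵐ x : ℝ, Tendsto (fun ε : ℝ ↦ Φ (x + ε * I)) (𝓝[>] 0) (𝓝 (Φ x)) := by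
    filter_upwards [hNc.ae_notMem volume] with x hx
    obtain ⟨hE, h1, h2⟩ := hgood x hx
    have hc : ContinuousAt Φ x := (hΦdiff x hE h1 h2).continuousAt
    have hpath : Tendsto (fun ε : ℝ ↦ (x : ℂ) + ε * I) (𝓝[>] 0) (𝓝 (x : ℂ)) := by
      have hc' : Continuous fun ε : ℝ ↦ (x : ℂ) + ε * I :=
        continuous_const.add (Complex.continuous_ofReal.mul continuous_const)
      exact (hc'.tendsto' 0 (x : ℂ) (by simp)).mono_left nhdsWithin_le_nhds
    exact hc.tendsto.comp hpath
  have hT := tendsto_integral_filter_of_dominated_convergence bound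
    (Filter.Eventually.of_forall hmeas) h_bound hbound_int h_lim
  have hev0 : (fun ε : ℝ ↦ ∫ x : ℝ, Φ (x + ε * I)) =ᶠ[𝓝[>] 0] fun _ ↦ 0 := by
    filter_upwards [Ioo_mem_nhdsGT (show (0 : ℝ) < δ / 2 by positivity)] with ε hε
    exact hzero ε hε.1 hε.2
  have hint0 : Integrable (fun x : ℝ ↦ Φ x) := by
    refine hbound_int.mono' ?_ ?_
    · simpa using hmeas 0
    · filter_upwards [hNc.ae_notMem volume] with x hx
      obtain ⟨-, h1, h2⟩ := hgood x hx
      have h := hkey' x (by simp) (by simp; positivity) h1 h2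
      simpa using h
  exact ⟨hint0, tendsto_nhds_unique (hT.congr' hev0) tendsto_const_nhds⟩

/-! ## The diagonal relation: `‖f_γ‖² = π/m_γ` -/

/-- The real part of the compensating term `P(x) = c/(x−γ) − c/(x−γ+i)`, `c = −i/m`, on the real
line: `Re P(γ + u) = (1/m)/(1+u²)` (a Poisson kernel). [folklore] -/
private theorem re_poissonTerm (m u : ℝ) :
    ((-I / (m : ℂ)) / (u : ℂ) - (-I / (m : ℂ)) / ((u : ℂ) + I)).re = 1 / m * (1 + u ^ 2)⁻¹ := by
  have h1 : ((-I / (m : ℂ)) / (u : ℂ)).re = 0 := by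
    rw [Complex.div_ofReal_re, Complex.div_ofReal_re]
    simp
  have hn : Complex.normSq ((u : ℂ) + I) = u ^ 2 + 1 := by
    rw [Complex.normSq_apply]
    simp
    ring
  have h2 : ((-I / (m : ℂ)) / ((u : ℂ) + I)).re = -(1 / m * (1 + u ^ 2)⁻¹) := by
    rw [Complex.div_re, hn]
    simp [Complex.div_ofReal_re, Complex.div_ofReal_im]
    field_simp
    ring
  rw [Complex.sub_re, h1, h2]
  ring

/-- For `v` in the closed upper half-plane, `|v + i| ≥ |v|`. [folklore] -/
private theorem norm_le_norm_add_I {v : ℂ} (hv : 0 ≤ v.im) : ‖v‖ ≤ ‖v + I‖ := by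
  rw [← sq_le_sq₀ (norm_nonneg _) (norm_nonneg _), Complex.sq_norm, Complex.sq_norm,
    Complex.normSq_apply, Complex.normSq_apply]
  simp
  nlinarith

/-- **The diagonal orthogonality relation**: under RH, for a zero `ρ` of multiplicity `m` with
(real) parameter `γ`, `x ↦ Re[A(x)/(E(x)(x−γ)²)] = |f_γ(x)|²` is integrable on `ℝ` with integral
`π/m`. The function `A(z)/(E(z)(z−γ)²)` has a simple pole at `γ` with residue
`c = Θ′(γ)/2 = −i/m` (the germ value); subtracting `P(z) = c/(z−γ) − c/(z−γ+i)` leaves a function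
`R` holomorphic on the closed upper half-plane with quadratic decay, so `∫_ℝ R = 0` (Cauchy,
boundary shift, dominated convergence), while `Re P(x) = (1/m)/(1+(x−γ)²)` integrates to `π/m`.
This is the normalisation `‖i(1+Θ)/(2(z−γ))‖² = π/m_γ` of Prop. 3.2 ("(3.5) is nothing but
(3.4)"). RH-CONSEQUENCE. [cite: Suzuki2023b, Prop. 3.2, p. 8 L6–44] -/
theorem integral_kernel_diag (hRH : RiemannHypothesis) {ρ : ℂ}
    (hρ : ρ ∈ riemannZetaNontrivialZeros) :
    Integrable (fun x : ℝ ↦ (lagariasXiA x /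
        (lagariasE x * (x - suzukiZeroParam ρ) * (x - suzukiZeroParam ρ))).re) ∧
      ∫ x : ℝ, (lagariasXiA x /
        (lagariasE x * (x - suzukiZeroParam ρ) * (x - suzukiZeroParam ρ))).re =
        Real.pi / (riemannZetaZeroOrder ρ : ℝ) := by
  set γc := suzukiZeroParam ρ with hγc
  set γ : ℝ := γc.re with hγ
  have hγr : γc = (γ : ℂ) := suzukiZeroParam_eq_ofReal hRH hρ
  have hm0 : (0 : ℝ) < riemannZetaZeroOrder ρ := FordL33.order_pos ⟨ρ, hρ⟩
  have hm1 : (1 : ℝ) ≤ riemannZetaZeroOrder ρ := by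
    exact_mod_cast riemannZetaNontrivialZeros.one_le_order hρ
  set mC : ℂ := (riemannZetaZeroOrder ρ : ℂ) with hmC
  have hmC0 : mC ≠ 0 := by rw [hmC]; exact_mod_cast hm0.ne'
  have hmCr : mC = ((riemannZetaZeroOrder ρ : ℝ) : ℂ) := by rw [hmC]; norm_cast
  -- the germ and the residue
  obtain ⟨q, hq, hqγ, hqev⟩ := exists_analyticAt_A_div_E_germ hρ
  set c : ℂ := -I / mC with hc
  have hqc : q γc = c := by rw [hqγ, hc]
  have hcn : ‖c‖ ≤ 1 := by
    rw [hc, norm_div, norm_neg, Complex.norm_I, hmCr, Complex.norm_real, Real.norm_eq_abs,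
      abs_of_pos hm0]
    exact (div_le_one hm0).2 hm1
  set Φ : ℂ → ℂ := fun z ↦ lagariasXiA z / (lagariasE z * (z - γc) * (z - γc)) with hΦ
  set P : ℂ → ℂ := fun z ↦ c / (z - γc) - c / (z - γc + I) with hP
  set R : ℂ → ℂ := fun z ↦ Φ z - P z with hR
  -- (i) `R` near `γc`
  have hI0 : ∀ w : ℂ, 0 ≤ w.im → w - γc + I ≠ 0 := by
    intro w hw h
    have := congrArg Complex.im h
    rw [hγr] at this
    simp at this
    linarith
  have hRev : ∀ᶠ z in 𝓝[≠] γc, R z = dslope q γc z + c / (z - γc + I) := by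
    filter_upwards [hqev, self_mem_nhdsWithin,
      mem_nhdsWithin_of_mem_nhds (Metric.ball_mem_nhds γc one_pos)] with z hz hne hball
    have hzγ : z - γc ≠ 0 := sub_ne_zero.2 hne
    have hzI : z - γc + I ≠ 0 := by
      intro h
      have h' : z - γc = -I := by linear_combination h
      have : dist z γc = 1 := by rw [dist_eq_norm, h', norm_neg, Complex.norm_I]
      rw [Metric.mem_ball] at hball
      linarith
    rw [← hγc] at hz
    rw [dslope_of_ne _ hne, slope_def_field, hqc, hz]
    simp only [hR, hΦ, hP, hc]
    field_simp
    ring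
  have hg_cont : ContinuousAt (fun z ↦ dslope q γc z + c / (z - γc + I)) γc := by
    have h1 : ContinuousAt (dslope q γc) γc := continuousAt_dslope_same.2 hq.differentiableAt
    have h2 : ContinuousAt (fun z ↦ c / (z - γc + I)) γc :=
      continuousAt_const.div ((continuousAt_id.sub continuousAt_const).add continuousAt_const)
        (hI0 γc (by rw [hγr, Complex.ofReal_im]))
    exact h1.add h2
  obtain ⟨δ, hδ, M₁, hM₁0, hbR⟩ : ∃ δ > 0, ∃ M : ℝ, 0 ≤ M ∧
      ∀ w : ℂ, w ≠ γc → dist w γc < δ → ‖R w‖ ≤ M := by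
    have hbd : ∀ᶠ w in 𝓝 γc, ‖dslope q γc w + c / (w - γc + I)‖ <
        ‖dslope q γc γc + c / (γc - γc + I)‖ + 1 :=
      hg_cont.norm.eventually_lt_const (lt_add_one _)
    have hev : ∀ᶠ w in 𝓝 γc, w ≠ γc → R w = dslope q γc w + c / (w - γc + I) :=
      eventually_nhdsWithin_iff.1 hRev
    obtain ⟨δ, hδ, hball⟩ := Metric.eventually_nhds_iff_ball.1 (hbd.and hev)
    refine ⟨δ, hδ, ‖dslope q γc γc + c / (γc - γc + I)‖ + 1, by positivity,
      fun w hw hdist ↦ ?_⟩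
    obtain ⟨h1, h2⟩ := hball w hdist
    rw [h2 hw]
    exact h1.le
  -- (ii) global bounds on the closed upper half-plane
  have hPform : ∀ w : ℂ, 0 ≤ w.im → w ≠ γc → P w = c * I / ((w - γc) * (w - γc + I)) := by
    intro w hw hne
    have h1 : w - γc ≠ 0 := sub_ne_zero.2 hne
    have h2 := hI0 w hw
    simp only [hP]
    field_simp
    ring
  have hPbound : ∀ w : ℂ, 0 ≤ w.im → w ≠ γc → ‖P w‖ ≤ 1 / ‖w - γc‖ ^ 2 := by
    intro w hw hne
    have h1 : 0 < ‖w - γc‖ := norm_pos_iff.2 (sub_ne_zero.2 hne)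
    have hvI : ‖w - γc‖ ≤ ‖w - γc + I‖ := norm_le_norm_add_I (by rw [hγr]; simpa using hw)
    rw [hPform w hw hne, norm_div, norm_mul, norm_mul, Complex.norm_I, mul_one]
    calc ‖c‖ / (‖w - γc‖ * ‖w - γc + I‖) ≤ 1 / (‖w - γc‖ * ‖w - γc‖) := by
          gcongr
      _ = 1 / ‖w - γc‖ ^ 2 := by rw [sq]
  have hRbound : ∀ w : ℂ, 0 ≤ w.im → w ≠ γc → ‖R w‖ ≤ 2 / ‖w - γc‖ ^ 2 := by
    intro w hw hne
    have hΦb : ‖Φ w‖ ≤ 1 / ‖w - γc‖ ^ 2 := by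
      have := norm_lagariasKernel_le hRH hw γc γc
      rwa [← sq] at this
    calc ‖R w‖ ≤ ‖Φ w‖ + ‖P w‖ := norm_sub_le _ _
      _ ≤ 1 / ‖w - γc‖ ^ 2 + 1 / ‖w - γc‖ ^ 2 := add_le_add hΦb (hPbound w hw hne)
      _ = 2 / ‖w - γc‖ ^ 2 := by ring
  -- regularity
  have hAd : Differentiable ℂ lagariasXiA := by
    have : lagariasXiA = fun z ↦ riemannXi (1 / 2 - I * z) := funext lagariasXiA_eq
    rw [this]
    exact differentiable_riemannXi.comp
      ((differentiable_const _).sub ((differentiable_const _).mul differentiable_id))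
  have hEd : Differentiable ℂ lagariasE := differentiable_lagariasE
  have hRdiff : ∀ z : ℂ, 0 ≤ z.im → lagariasE z ≠ 0 → z ≠ γc → DifferentiableAt ℂ R z := by
    intro z hz hE hne
    have hΦd : DifferentiableAt ℂ Φ z :=
      (hAd z).div (((hEd z).mul (differentiableAt_id.sub_const _)).mul
        (differentiableAt_id.sub_const _))
        (mul_ne_zero (mul_ne_zero hE (sub_ne_zero.2 hne)) (sub_ne_zero.2 hne))
    have hPd : DifferentiableAt ℂ P z :=
      ((differentiableAt_const c).div (differentiableAt_id.sub_const _) (sub_ne_zero.2 hne)).sub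
        ((differentiableAt_const c).div ((differentiableAt_id.sub_const _).add_const _)
          (hI0 z hz))
    exact hΦd.sub hPd
  have hΦm : Measurable Φ :=
    hAd.continuous.measurable.div ((hEd.continuous.measurable.mul
      (measurable_id.sub_const _)).mul (measurable_id.sub_const _))
  have hPm : Measurable P :=
    (measurable_const.div (measurable_id.sub_const _)).sub
      (measurable_const.div ((measurable_id.sub_const _).add_const _))
  have hRm : Measurable R := hΦm.sub hPm
  have hmeas : ∀ ε : ℝ, AEStronglyMeasurable (fun x : ℝ ↦ R (x + ε * I)) :=
    fun ε ↦ (hRm.comp (Complex.continuous_ofReal.measurable.add_const _)).aestronglyMeasurable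
  have hne_of_im : ∀ w : ℂ, 0 < w.im → w ≠ γc := by
    intro w hw h
    rw [h, hγr, Complex.ofReal_im] at hw
    exact lt_irrefl _ hw
  -- the window estimate
  set L : ℝ := max (M₁ * (1 + (δ / 2) ^ 2)) (2 * (1 + 1 / (δ / 2) ^ 2)) with hL
  have hL0 : 0 ≤ L := le_trans (by positivity) (le_max_left _ _)
  set bound : ℝ → ℝ := fun x ↦ L * (1 + (x - γ) ^ 2)⁻¹ with hbound
  have hbound_int : Integrable bound := (integrable_inv_one_add_sq_sub γ).const_mul L
  have hkey : ∀ w : ℂ, 0 ≤ w.im → w.im < δ / 2 → w ≠ γc → ‖R w‖ ≤ bound w.re := by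
    intro w hw hwδ hne
    set x := w.re with hx
    have hre1 : (w - γc).re = x - γ := by simp [hx, hγr]
    have hn1 : |x - γ| ≤ ‖w - γc‖ := by rw [← hre1]; exact Complex.abs_re_le_norm _
    have hd1 : ‖w - γc‖ ≤ |x - γ| + w.im := by
      have : w - γc = ((x - γ : ℝ) : ℂ) + (w.im : ℝ) * I := by
        rw [hγr]; apply Complex.ext <;> simp [hx]
      rw [this]
      calc ‖((x - γ : ℝ) : ℂ) + (w.im : ℝ) * I‖
          ≤ ‖((x - γ : ℝ) : ℂ)‖ + ‖((w.im : ℝ) : ℂ) * I‖ := norm_add_le _ _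
        _ = |x - γ| + w.im := by
          rw [Complex.norm_real, Real.norm_eq_abs, norm_mul, Complex.norm_I, mul_one,
            Complex.norm_real, Real.norm_eq_abs, abs_of_nonneg hw]
    have hpos1 : 0 < (1 + (x - γ) ^ 2)⁻¹ := by positivity
    by_cases hx1 : |x - γ| < δ / 2
    · have hdist : dist w γc < δ := by rw [dist_eq_norm]; linarith
      calc ‖R w‖ ≤ M₁ := hbR w hne hdist
        _ ≤ M₁ * (1 + (δ / 2) ^ 2) * (1 + (x - γ) ^ 2)⁻¹ := const_le_inv_one_add_sq hM₁0 hx1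
        _ ≤ L * (1 + (x - γ) ^ 2)⁻¹ := by
          gcongr
          exact le_max_left _ _
    · rw [not_lt] at hx1
      have ha : 0 < |x - γ| := lt_of_lt_of_le (by positivity) hx1
      calc ‖R w‖ ≤ 2 / ‖w - γc‖ ^ 2 := hRbound w hw hne
        _ ≤ 2 / |x - γ| ^ 2 := by gcongr
        _ = 2 * (1 / (x - γ) ^ 2) := by rw [sq_abs]; ring
        _ ≤ 2 * ((1 + 1 / (δ / 2) ^ 2) * (1 + (x - γ) ^ 2)⁻¹) := by
          gcongr
          exact inv_sq_le_inv_one_add_sq (by positivity) hx1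
        _ = 2 * (1 + 1 / (δ / 2) ^ 2) * (1 + (x - γ) ^ 2)⁻¹ := by ring
        _ ≤ L * (1 + (x - γ) ^ 2)⁻¹ := by
          gcongr
          exact le_max_right _ _
  -- (iii) the shifted integrals of `R` vanish
  have hzero : ∀ ε : ℝ, 0 < ε → ε < δ / 2 → ∫ x : ℝ, R (x + ε * I) = 0 := by
    intro ε hε hεδ
    have himε : ∀ x : ℝ, ((x : ℂ) + ε * I).im = ε := fun x ↦ by simp
    refine integral_shift_eq_zero (K := 8) (R₀ := 2 * (‖γc‖ + 1)) hε
      (fun z hz ↦ hRdiff z hz.le (lagariasE_ne_zero_of_im_pos hRH hz) (hne_of_im z hz))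
      (fun z hz hzR ↦ ?_) ?_
    · have h1 : ‖z‖ / 2 ≤ ‖z - γc‖ := by
        have := norm_sub_norm_le z γc
        linarith
      have hzpos : 0 < ‖z‖ := by linarith [norm_nonneg γc]
      calc ‖R z‖ ≤ 2 / ‖z - γc‖ ^ 2 := hRbound z hz.le (hne_of_im z hz)
        _ ≤ 2 / (‖z‖ / 2) ^ 2 := by
            apply div_le_div_of_nonneg_left (by norm_num) (by positivity)
            exact pow_le_pow_left₀ (by positivity) h1 2
        _ = 8 / ‖z‖ ^ 2 := by field_simp; ring
    · refine hbound_int.mono' (hmeas ε) (Filter.Eventually.of_forall fun x ↦ ?_)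
      have h := hkey (x + ε * I) (by rw [himε]; exact hε.le) (by rwa [himε])
        (hne_of_im _ (by rw [himε]; exact hε))
      simpa using h
  -- (iv) dominated convergence
  have h_bound : ∀ᶠ ε : ℝ in 𝓝[>] 0, ∀ᵐ x : ℝ, ‖R (x + ε * I)‖ ≤ bound x := by
    filter_upwards [Ioo_mem_nhdsGT (show (0 : ℝ) < δ / 2 by positivity)] with ε hε
    refine Filter.Eventually.of_forall fun x ↦ ?_
    have himε : ((x : ℂ) + ε * I).im = ε := by simp
    have h := hkey (x + ε * I) (by rw [himε]; exact hε.1.le) (by rw [himε]; exact hε.2)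
      (hne_of_im _ (by rw [himε]; exact hε.1))
    simpa using h
  set N : Set ℝ := {x : ℝ | riemannXi (1 / 2 - I * x) = 0} ∪ {γ} with hN
  have hNc : N.Countable := countable_critical_zero_ordinates.union (Set.toFinite _).countable
  have hgood : ∀ x : ℝ, x ∉ N → lagariasE x ≠ 0 ∧ (x : ℂ) ≠ γc := by
    intro x hx
    simp only [hN, Set.mem_union, Set.mem_setOf_eq, Set.mem_singleton_iff, not_or] at hx
    refine ⟨fun h ↦ hx.1 ((lagariasE_ofReal_eq_zero_iff x).1 h).1, ?_⟩
    rw [hγr]; exact_mod_cast hx.2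
  have h_lim : ∀ᵐ x : ℝ, Tendsto (fun ε : ℝ ↦ R (x + ε * I)) (𝓝[>] 0) (𝓝 (R x)) := by
    filter_upwards [hNc.ae_notMem volume] with x hx
    obtain ⟨hE, h1⟩ := hgood x hx
    have hc' : ContinuousAt R x := (hRdiff x (by simp) hE h1).continuousAt
    have hpath : Tendsto (fun ε : ℝ ↦ (x : ℂ) + ε * I) (𝓝[>] 0) (𝓝 (x : ℂ)) := by
      have hc'' : Continuous fun ε : ℝ ↦ (x : ℂ) + ε * I :=
        continuous_const.add (Complex.continuous_ofReal.mul continuous_const)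
      exact (hc''.tendsto' 0 (x : ℂ) (by simp)).mono_left nhdsWithin_le_nhds
    exact hc'.tendsto.comp hpath
  have hT := tendsto_integral_filter_of_dominated_convergence bound
    (Filter.Eventually.of_forall hmeas) h_bound hbound_int h_lim
  have hev0 : (fun ε : ℝ ↦ ∫ x : ℝ, R (x + ε * I)) =ᶠ[𝓝[>] 0] fun _ ↦ 0 := by
    filter_upwards [Ioo_mem_nhdsGT (show (0 : ℝ) < δ / 2 by positivity)] with ε hε
    exact hzero ε hε.1 hε.2
  have hRint : Integrable (fun x : ℝ ↦ R x) := by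
    refine hbound_int.mono' ?_ ?_
    · simpa using hmeas 0
    · filter_upwards [hNc.ae_notMem volume] with x hx
      obtain ⟨-, h1⟩ := hgood x hx
      have h := hkey x (by simp) (by simp; positivity) h1
      simpa using h
  have hRzero : ∫ x : ℝ, R x = 0 := tendsto_nhds_unique (hT.congr' hev0) tendsto_const_nhds
  -- (v) the real parts on the real line
  have hPre : ∀ x : ℝ, (P x).re = 1 / (riemannZetaZeroOrder ρ : ℝ) * (1 + (x - γ) ^ 2)⁻¹ := by
    intro x
    have : P x = (-I / ((riemannZetaZeroOrder ρ : ℝ) : ℂ)) / ((x - γ : ℝ) : ℂ) -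
        (-I / ((riemannZetaZeroOrder ρ : ℝ) : ℂ)) / (((x - γ : ℝ) : ℂ) + I) := by
      simp only [hP, hc, hmCr, hγr]
      push_cast
      ring_nf
    rw [this, re_poissonTerm]
  have hdecomp : ∀ x : ℝ, (Φ x).re =
      (R x).re + 1 / (riemannZetaZeroOrder ρ : ℝ) * (1 + (x - γ) ^ 2)⁻¹ := by
    intro x
    rw [← hPre x, ← Complex.add_re]
    simp only [hR]
    ring_nf
  have hRre : Integrable (fun x : ℝ ↦ (R x).re) := by
    have := hRint.re
    simpa only [RCLike.re_to_complex] using this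
  have hsum_int : Integrable (fun x : ℝ ↦
      (R x).re + 1 / (riemannZetaZeroOrder ρ : ℝ) * (1 + (x - γ) ^ 2)⁻¹) :=
    hRre.add ((integrable_inv_one_add_sq_sub γ).const_mul _)
  have hfun : (fun x : ℝ ↦ (Φ x).re) =
      fun x : ℝ ↦ (R x).re + 1 / (riemannZetaZeroOrder ρ : ℝ) * (1 + (x - γ) ^ 2)⁻¹ :=
    funext hdecomp
  refine ⟨by rw [hfun]; exact hsum_int, ?_⟩
  rw [hfun, integral_add hRre ((integrable_inv_one_add_sq_sub γ).const_mul _),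
    MeasureTheory.integral_const_mul]
  have h1 : ∫ x : ℝ, (R x).re = 0 := by
    have := integral_re hRint
    simp only [RCLike.re_to_complex] at this
    rw [this, hRzero, Complex.zero_re]
  have h2 : ∫ x : ℝ, (1 + (x - γ) ^ 2)⁻¹ = Real.pi := by
    have := integral_sub_right_eq_self (μ := (volume : Measure ℝ)) (fun x : ℝ ↦ (1 + x ^ 2)⁻¹) γ
    rw [this, integral_univ_inv_one_add_sq]
  rw [h1, h2, zero_add]
  field_simp

/-! ## Orthogonal series in a Hilbert space (the Bessel–Parseval step) -/

/-- Pythagoras for a finite pairwise-orthogonal family. [folklore] -/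
private theorem norm_sum_sq_of_orthogonal {ι E : Type*} [NormedAddCommGroup E]
    [InnerProductSpace ℂ E] [DecidableEq ι] (V : ι → E)
    (hV : Pairwise fun i j ↦ inner ℂ (V i) (V j) = 0) (s : Finset ι) :
    ‖∑ i ∈ s, V i‖ ^ 2 = ∑ i ∈ s, ‖V i‖ ^ 2 := by
  induction s using Finset.induction_on with
  | empty => simp
  | insert a s ha ih =>
    rw [Finset.sum_insert ha, Finset.sum_insert ha, ← ih]
    have horth : inner ℂ (V a) (∑ i ∈ s, V i) = 0 := by
      rw [inner_sum]
      refine Finset.sum_eq_zero fun i hi ↦ hV ?_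
      rintro rfl
      exact ha hi
    have h := norm_add_sq_eq_norm_sq_add_norm_sq_of_inner_eq_zero (V a) (∑ i ∈ s, V i) horth
    nlinarith [h]

/-- **An orthogonal family with square-summable norms is summable, and the squared norm of the sum
is the sum of the squared norms** (Bessel–Parseval for orthogonal series in a Hilbert space).
[folklore] -/
private theorem hasSum_of_orthogonal {ι E : Type*} [NormedAddCommGroup E] [InnerProductSpace ℂ E]
    [CompleteSpace E] (V : ι → E) (hV : Pairwise fun i j ↦ inner ℂ (V i) (V j) = 0)
    (hs : Summable fun i ↦ ‖V i‖ ^ 2) :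
    ∃ S : E, HasSum V S ∧ HasSum (fun i ↦ ‖V i‖ ^ 2) (‖S‖ ^ 2) := by
  classical
  have hsumV : Summable V := by
    refine summable_iff_vanishing_norm.2 fun ε hε ↦ ?_
    obtain ⟨s, hs'⟩ := summable_iff_vanishing_norm.1 hs (ε ^ 2) (by positivity)
    refine ⟨s, fun t ht ↦ ?_⟩
    have h1 := hs' t ht
    rw [Real.norm_of_nonneg (Finset.sum_nonneg fun i _ ↦ by positivity)] at h1
    rw [← norm_sum_sq_of_orthogonal V hV t] at h1
    exact lt_of_pow_lt_pow_left₀ 2 hε.le h1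
  obtain ⟨S, hS⟩ := hsumV
  refine ⟨S, hS, ?_⟩
  have h1 : Tendsto (fun s : Finset ι ↦ ‖∑ i ∈ s, V i‖ ^ 2) atTop (𝓝 (‖S‖ ^ 2)) :=
    (hS.comp tendsto_id).norm.pow 2
  have h2 : (fun s : Finset ι ↦ ‖∑ i ∈ s, V i‖ ^ 2) = fun s ↦ ∑ i ∈ s, ‖V i‖ ^ 2 :=
    funext fun s ↦ norm_sum_sq_of_orthogonal V hV s
  rw [h2] at h1
  exact h1

/-- The set of non-trivial zeros is countably infinite: it can be enumerated by `ℕ`. [folklore] -/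
private theorem nonempty_equiv_nat_nontrivialZeros : Nonempty (ℕ ≃ riemannZetaNontrivialZeros) := by
  have hc : Countable riemannZetaNontrivialZeros := riemannZetaNontrivialZeros_countable.to_subtype
  have hinf : (riemannZetaNontrivialZeros : Set ℂ).Infinite := by
    have h := hardy_infinite_zeros_on_critical_line_holds
    refine Set.infinite_of_injOn_mapsTo (f := fun t : ℝ ↦ (1 / 2 : ℂ) + t * I) ?_ ?_ h
    · intro a _ b _ hab
      have := congrArg Complex.im hab
      simpa using this
    · intro t ht
      exact mem_riemannZetaNontrivialZeros_iff_holds.2 ⟨ht, by norm_num, by norm_num⟩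
  have : Infinite riemannZetaNontrivialZeros := hinf.to_subtype
  exact nonempty_equiv_of_countable

/-! ## `‖G_n‖² = π Σ_ρ m_ρ |1 − (1 − 1/ρ)ⁿ|²` under RH (Bessel–Parseval for (3.6)) -/

/-- Under RH, `1 − ρ = ρ̄` for every non-trivial zero, so the second bracket of (3.8) is the
complex conjugate of the first. RH-CONSEQUENCE. [cite: Suzuki2023b, eq. (3.7), p. 8 L108–122] -/
theorem bracket_one_sub_eq_conj (hRH : RiemannHypothesis) {ρ : ℂ}
    (hρ : ρ ∈ riemannZetaNontrivialZeros) (n : ℕ) :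
    1 - (1 - 1 / (1 - ρ)) ^ n = conj (1 - (1 - 1 / ρ) ^ n) := by
  have hre : ρ.re = 1 / 2 := by
    refine hRH ρ (riemannZetaNontrivialZeros.zeta_eq_zero hρ) ?_
      (riemannZetaNontrivialZeros.ne_one hρ)
    rintro ⟨k, hk⟩
    have := riemannZetaNontrivialZeros.re_pos hρ
    rw [hk] at this
    simp at this
    linarith [(k.cast_nonneg : (0 : ℝ) ≤ k)]
  have h1 : 1 - ρ = conj ρ := by
    apply Complex.ext
    · simp [hre]; norm_num
    · simp
  rw [h1]
  simp only [map_sub, map_one, map_pow, map_div₀]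

/-- Under RH, `m_ρ{[1−(1−1/ρ)ⁿ] + [1−(1−1/(1−ρ))ⁿ]} = m_ρ |1−(1−1/ρ)ⁿ|²` ((3.7): the sum of the two
brackets is their product, and the second is the conjugate of the first). RH-CONSEQUENCE.
[cite: Suzuki2023b, eq. (3.7), p. 8 L108–122] -/
theorem zeroOrder_mul_bracket_eq_normSq (hRH : RiemannHypothesis)
    (ρ : riemannZetaNontrivialZeros) (n : ℕ) :
    (riemannZetaZeroOrder (ρ : ℂ) : ℂ) *
        ((1 - (1 - 1 / (ρ : ℂ)) ^ n) + (1 - (1 - 1 / (1 - (ρ : ℂ))) ^ n)) =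
      (((riemannZetaZeroOrder (ρ : ℂ) : ℝ) * ‖1 - (1 - 1 / (ρ : ℂ)) ^ n‖ ^ 2 : ℝ) : ℂ) := by
  have h0 : (ρ : ℂ) ≠ 0 := FordL33.coe_ne_zero ρ
  have h1 : (ρ : ℂ) ≠ 1 := riemannZetaNontrivialZeros.ne_one ρ.2
  rw [bracket_add_eq_bracket_mul h0 h1, bracket_one_sub_eq_conj hRH ρ.2, Complex.mul_conj,
    Complex.normSq_eq_norm_sq]
  push_cast
  ring

/-- **`‖G_n‖²_{L²(ℝ)} = π Σ_{ρ∈𝒵} m_ρ |1 − (1−1/ρ)ⁿ|²` under RH** — the norm computation of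
§3.4 ("Applying Proposition 3.2 to calculate the norm of `G_n(z)` by (3.6)"), here by
Bessel–Parseval for the orthogonal family `{m_ρ[1−(1−1/ρ)ⁿ]·i(1+Θ)/(2(x−γ_ρ))}` in `L²(ℝ)`
(orthogonality relations `integral_kernel_offDiag`, `integral_kernel_diag`; the pointwise
expansion (3.6) `Suzuki2023b_eq0225_1_holds` identifies the `L²`-sum with `G_n` a.e.).
RH-CONSEQUENCE. [cite: Suzuki2023b, §3.4, eq. (3.8), p. 8 L124–145] -/
theorem hasSum_liModelGNormSq (hRH : RiemannHypothesis) {n : ℕ} (hn : 1 ≤ n) :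
    HasSum (fun ρ : riemannZetaNontrivialZeros ↦
      Real.pi * (riemannZetaZeroOrder (ρ : ℂ) : ℝ) * ‖1 - (1 - 1 / (ρ : ℂ)) ^ n‖ ^ 2)
      (liModelGNormSq n) := by
  classical
  -- notation
  set m : riemannZetaNontrivialZeros → ℝ := fun ρ ↦ (riemannZetaZeroOrder (ρ : ℂ) : ℝ) with hm
  set b : riemannZetaNontrivialZeros → ℂ := fun ρ ↦ 1 - (1 - 1 / (ρ : ℂ)) ^ n with hb
  set a : riemannZetaNontrivialZeros → ℂ := fun ρ ↦ (riemannZetaZeroOrder (ρ : ℂ) : ℂ) * b ρ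
    with ha
  set f : riemannZetaNontrivialZeros → ℝ → ℂ := fun ρ x ↦
    I * (1 + lagariasTheta x) / (2 * ((x : ℂ) - suzukiZeroParam ρ)) with hf
  set u : riemannZetaNontrivialZeros → ℝ → ℂ := fun ρ x ↦ a ρ * f ρ x with hu
  set G : ℝ → ℂ := fun x ↦ liModelG n x with hG
  have hm_pos : ∀ ρ, 0 < m ρ := fun ρ ↦ FordL33.order_pos ρ
  have hmC : ∀ ρ : riemannZetaNontrivialZeros,
      (riemannZetaZeroOrder (ρ : ℂ) : ℂ) = ((m ρ : ℝ) : ℂ) := fun ρ ↦ by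
    simp [hm]
  -- measurability of the `f ρ`
  have hΘm : Measurable fun x : ℝ ↦ lagariasTheta x := by
    have hE : Continuous lagariasE := differentiable_lagariasE.continuous
    have hsE : Continuous (sharp lagariasE) :=
      Complex.continuous_conj.comp (hE.comp Complex.continuous_conj)
    have : Measurable fun z : ℂ ↦ lagariasTheta z := by
      unfold lagariasTheta
      exact hsE.measurable.div hE.measurable
    exact this.comp Complex.measurable_ofReal
  have hf_meas : ∀ ρ, Measurable (f ρ) := fun ρ ↦
    (measurable_const.mul (measurable_const.add hΘm)).div
      (measurable_const.mul (Complex.measurable_ofReal.sub_const _))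
  -- the orthogonality relations
  have horth : ∀ ρ ρ' : riemannZetaNontrivialZeros,
      Integrable (fun x ↦ f ρ x * conj (f ρ' x)) ∧
      ∫ x, f ρ x * conj (f ρ' x) = if ρ = ρ' then ((Real.pi / m ρ : ℝ) : ℂ) else 0 := by
    intro ρ ρ'
    have hγr := suzukiZeroParam_eq_ofReal hRH ρ.2
    have hγr' := suzukiZeroParam_eq_ofReal hRH ρ'.2
    set k : ℝ → ℂ := fun x ↦ lagariasXiA x /
      (lagariasE x * (x - suzukiZeroParam ρ) * (x - suzukiZeroParam ρ')) with hk
    have hae : (fun x ↦ f ρ x * conj (f ρ' x)) =ᵐ[volume] fun x ↦ (((k x).re : ℝ) : ℂ) := by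
      filter_upwards [countable_critical_zero_ordinates.ae_notMem volume] with x hx
      have hE : lagariasE x ≠ 0 := fun h ↦ hx ((lagariasE_ofReal_eq_zero_iff x).1 h).1
      simp only [hf, hk]
      rw [hγr, hγr']
      exact suzukiTerm_mul_conj_ofReal _ _ hE
    by_cases hρρ : ρ = ρ'
    · subst hρρ
      obtain ⟨hint, hval⟩ := integral_kernel_diag hRH ρ.2
      have hint' : Integrable (fun x ↦ (((k x).re : ℝ) : ℂ)) := by
        simpa [hk] using Complex.ofRealCLM.integrable_comp hint
      refine ⟨hint'.congr hae.symm, ?_⟩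
      rw [integral_congr_ae hae, integral_complex_ofReal, hval, if_pos rfl]
    · have hne : (ρ : ℂ) ≠ ρ' := fun h ↦ hρρ (Subtype.ext h)
      obtain ⟨hint, hval⟩ := integral_kernel_offDiag hRH ρ.2 ρ'.2 hne
      have hre' : Integrable (fun x ↦ (k x).re) := by
        have := hint.re
        simpa only [RCLike.re_to_complex, hk] using this
      have hint' : Integrable (fun x ↦ (((k x).re : ℝ) : ℂ)) := by
        simpa [hk] using Complex.ofRealCLM.integrable_comp hre'
      refine ⟨hint'.congr hae.symm, ?_⟩
      rw [integral_congr_ae hae, integral_complex_ofReal, if_neg hρρ]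
      have h2 := integral_re hint
      simp only [RCLike.re_to_complex] at h2
      rw [h2, hval, Complex.zero_re, Complex.ofReal_zero]
  -- square-integrability
  have hf_sq : ∀ ρ, Integrable (fun x ↦ ‖f ρ x‖ ^ 2) := by
    intro ρ
    have h := (horth ρ ρ).1.re
    have hfun : (fun x ↦ ‖f ρ x‖ ^ 2) = fun x ↦ RCLike.re (f ρ x * conj (f ρ x)) := by
      funext x
      rw [Complex.mul_conj, RCLike.re_to_complex, Complex.ofReal_re, Complex.normSq_eq_norm_sq]
    rw [hfun]
    exact h
  have hmem : ∀ ρ, MemLp (u ρ) 2 (volume : Measure ℝ) := by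
    intro ρ
    have hf2 : MemLp (f ρ) 2 (volume : Measure ℝ) :=
      (memLp_two_iff_integrable_sq_norm (hf_meas ρ).aestronglyMeasurable).2 (hf_sq ρ)
    exact hf2.const_mul (a ρ)
  -- the vectors of `L²(ℝ)`
  set V : riemannZetaNontrivialZeros → Lp ℂ 2 (volume : Measure ℝ) :=
    fun ρ ↦ (hmem ρ).toLp (u ρ) with hV
  have hinner : ∀ ρ ρ', inner ℂ (V ρ) (V ρ') =
      conj (a ρ) * a ρ' * (if ρ = ρ' then ((Real.pi / m ρ : ℝ) : ℂ) else 0) := by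
    intro ρ ρ'
    rw [MeasureTheory.L2.inner_def]
    have hae : (fun x ↦ inner ℂ ((V ρ : ℝ → ℂ) x) ((V ρ' : ℝ → ℂ) x)) =ᵐ[volume]
        fun x ↦ conj (a ρ) * a ρ' * conj (f ρ x * conj (f ρ' x)) := by
      filter_upwards [MemLp.coeFn_toLp (hmem ρ), MemLp.coeFn_toLp (hmem ρ')] with x hx hx'
      simp only [hV]
      rw [hx, hx', RCLike.inner_apply']
      simp only [hu, map_mul, Complex.conj_conj]
      ring
    rw [integral_congr_ae hae, MeasureTheory.integral_const_mul, integral_conj, (horth ρ ρ').2]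
    split_ifs <;> simp
  have hnormsq : ∀ ρ, ‖V ρ‖ ^ 2 = Real.pi * m ρ * ‖b ρ‖ ^ 2 := by
    intro ρ
    have h1 := inner_self_eq_norm_sq (𝕜 := ℂ) (V ρ)
    rw [← h1, hinner, if_pos rfl]
    have ha' : a ρ = ((m ρ : ℝ) : ℂ) * b ρ := by simp only [ha, hmC]
    have hm0 : ((m ρ : ℝ) : ℂ) ≠ 0 := Complex.ofReal_ne_zero.2 (hm_pos ρ).ne'
    have hbb : (starRingEnd ℂ) (b ρ) * b ρ = ((‖b ρ‖ ^ 2 : ℝ) : ℂ) := by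
      rw [mul_comm, Complex.mul_conj, Complex.normSq_eq_norm_sq]
    have key : (starRingEnd ℂ) (a ρ) * a ρ * ((Real.pi / m ρ : ℝ) : ℂ) =
        ((Real.pi * m ρ * ‖b ρ‖ ^ 2 : ℝ) : ℂ) := by
      rw [ha', map_mul, Complex.conj_ofReal]
      calc ((m ρ : ℝ) : ℂ) * (starRingEnd ℂ) (b ρ) * (((m ρ : ℝ) : ℂ) * b ρ) *
            ((Real.pi / m ρ : ℝ) : ℂ)
          = ((m ρ : ℝ) : ℂ) * ((m ρ : ℝ) : ℂ) * ((starRingEnd ℂ) (b ρ) * b ρ) *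
            ((Real.pi / m ρ : ℝ) : ℂ) := by ring
        _ = ((Real.pi * m ρ * ‖b ρ‖ ^ 2 : ℝ) : ℂ) := by
            rw [hbb]
            push_cast
            field_simp
    rw [key, RCLike.re_to_complex, Complex.ofReal_re]
  have horthV : Pairwise fun ρ ρ' ↦ inner ℂ (V ρ) (V ρ') = 0 := fun ρ ρ' h ↦ by
    show inner ℂ (V ρ) (V ρ') = 0
    rw [hinner, if_neg h, mul_zero]
  -- square-summability of the norms ((3.7): `Σ m |b|² < ∞`)
  have hsumm : Summable fun ρ ↦ ‖V ρ‖ ^ 2 := by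
    have hs := ((summable_zeroOrder_mul_bracket n).norm).mul_left Real.pi
    refine hs.congr fun ρ ↦ ?_
    rw [hnormsq, zeroOrder_mul_bracket_eq_normSq hRH ρ n, Complex.norm_real, Real.norm_eq_abs,
      abs_of_nonneg (mul_nonneg (hm_pos ρ).le (sq_nonneg _))]
    ring
  obtain ⟨S, hS, hSnorm⟩ := hasSum_of_orthogonal V horthV hsumm
  -- an enumeration, and the partial sums as a sequence in `L²`
  obtain ⟨e⟩ := nonempty_equiv_nat_nontrivialZeros
  have hSe : HasSum (V ∘ e) S := (Equiv.hasSum_iff e).2 hS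
  have hT : Tendsto (fun N ↦ ∑ k ∈ Finset.range N, V (e k)) atTop (𝓝 S) := hSe.tendsto_sum_nat
  have hLp : Tendsto (fun N ↦ eLpNorm ((⇑(∑ k ∈ Finset.range N, V (e k)) : ℝ → ℂ) - ⇑S) 2
      (volume : Measure ℝ)) atTop (𝓝 0) :=
    (Lp.tendsto_Lp_iff_tendsto_eLpNorm' _ _).1 hT
  have hInMeas : TendstoInMeasure volume
      (fun N ↦ ((⇑(∑ k ∈ Finset.range N, V (e k)) : ℝ → ℂ))) atTop (⇑S) :=
    tendstoInMeasure_of_tendsto_eLpNorm (by norm_num) (fun N ↦ Lp.aestronglyMeasurable _)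
      (Lp.aestronglyMeasurable _) hLp
  obtain ⟨ns, hns, hlim⟩ := hInMeas.exists_seq_tendsto_ae
  -- the partial sums, pointwise
  have hcoe : ∀ᵐ x : ℝ, ∀ N : ℕ,
      ((⇑(∑ k ∈ Finset.range N, V (e k)) : ℝ → ℂ)) x = ∑ k ∈ Finset.range N, u (e k) x := by
    have hV' : ∀ᵐ x : ℝ, ∀ k : ℕ, ((V (e k) : ℝ → ℂ)) x = u (e k) x :=
      ae_all_iff.2 fun k ↦ MemLp.coeFn_toLp (hmem (e k))
    have hsum' : ∀ᵐ x : ℝ, ∀ N : ℕ, ((⇑(∑ k ∈ Finset.range N, V (e k)) : ℝ → ℂ)) x =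
        ∑ k ∈ Finset.range N, ((V (e k) : ℝ → ℂ)) x :=
      ae_all_iff.2 fun N ↦ (Lp.coeFn_finsetSum (Finset.range N) (fun k ↦ V (e k))).mono
        fun x hx ↦ by rw [hx, Finset.sum_apply]
    filter_upwards [hV', hsum'] with x hx hx' N
    rw [hx' N]
    exact Finset.sum_congr rfl fun k _ ↦ hx k
  -- the pointwise expansion (3.6), a.e.
  have hexp : ∀ᵐ x : ℝ, HasSum (fun ρ ↦ u ρ x) (G x) := by
    filter_upwards [countable_critical_zero_ordinates.ae_notMem volume] with x hx
    have hξ : riemannXi (1 / 2 - I * x) ≠ 0 := hx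
    have hE : lagariasE x ≠ 0 := fun h ↦ hx ((lagariasE_ofReal_eq_zero_iff x).1 h).1
    have h := Suzuki2023b_eq0225_1_holds n hn x hξ hE
    refine h.congr_fun fun ρ ↦ ?_
    simp only [hu, ha, hf]
    ring
  -- `S = G_n` almost everywhere
  have hSG : ∀ᵐ x : ℝ, (⇑S : ℝ → ℂ) x = G x := by
    filter_upwards [hlim, hcoe, hexp] with x hx1 hx2 hx3
    have h4 : Tendsto (fun j ↦ ∑ k ∈ Finset.range (ns j), u (e k) x) atTop (𝓝 (G x)) :=
      (((Equiv.hasSum_iff e).2 hx3).tendsto_sum_nat).comp hns.tendsto_atTop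
    have h5 : Tendsto (fun j ↦ ((⇑(∑ k ∈ Finset.range (ns j), V (e k)) : ℝ → ℂ)) x) atTop
        (𝓝 (G x)) := h4.congr fun j ↦ (hx2 (ns j)).symm
    exact tendsto_nhds_unique hx1 h5
  -- the norm of `S` is the `L²` norm of `G_n`
  have hSnorm' : ‖S‖ ^ 2 = ∫ x : ℝ, ‖(⇑S : ℝ → ℂ) x‖ ^ 2 := by
    rw [← inner_self_eq_norm_sq (𝕜 := ℂ), MeasureTheory.L2.inner_def]
    have h3 : ∀ x : ℝ, inner ℂ ((⇑S : ℝ → ℂ) x) ((⇑S : ℝ → ℂ) x) =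
        ((‖(⇑S : ℝ → ℂ) x‖ ^ 2 : ℝ) : ℂ) := by
      intro x
      rw [inner_self_eq_norm_sq_to_K]
      norm_cast
    simp_rw [h3]
    rw [integral_complex_ofReal]
    simp
  have hGnorm : liModelGNormSq n = ∫ x : ℝ, ‖(⇑S : ℝ → ℂ) x‖ ^ 2 := by
    rw [liModelGNormSq]
    exact integral_congr_ae (hSG.mono fun x hx ↦ by
      simp only [hG] at hx
      show ‖liModelG n x‖ ^ 2 = ‖(⇑S : ℝ → ℂ) x‖ ^ 2
      rw [hx])
  rw [hGnorm, ← hSnorm']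
  refine hSnorm.congr_fun fun ρ ↦ ?_
  rw [hnormsq]

/-! ## The discharge of (3.8) and of Theorem 1.1 -/

/-- **[Su23b] eq. (3.8) (discharge of `Suzuki2023b_eq_s301`)**: under RH, for every `n ≥ 1`,
`Σ_{ρ∈𝒵} m_ρ{[1−(1−1/ρ)ⁿ] + [1−(1−1/(1−ρ))ⁿ]} = ‖G_n‖²/π`. RH-CONSEQUENCE (explicit binder).
[cite: Suzuki2023b, eq. (3.8), p. 8 L140–157] -/
theorem Suzuki2023b_eq_s301_holds : Suzuki2023b_eq_s301 := by
  intro hRH n hn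
  have h := (hasSum_liModelGNormSq hRH hn).div_const Real.pi
  have h2 : HasSum (fun ρ : riemannZetaNontrivialZeros ↦
      (riemannZetaZeroOrder (ρ : ℂ) : ℝ) * ‖1 - (1 - 1 / (ρ : ℂ)) ^ n‖ ^ 2)
      (liModelGNormSq n / Real.pi) := by
    refine h.congr_fun fun ρ ↦ ?_
    field_simp
  have h3 := (Complex.hasSum_ofReal.2 h2 :)
  refine h3.congr_fun fun ρ ↦ ?_
  exact zeroOrder_mul_bracket_eq_normSq hRH ρ n

/-- **[Su23b] Theorem 1.1, the necessity ("only if") direction (discharge of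
`Suzuki2023b_thm11_onlyif`)**: RH implies `λ_n = (2π)^{−1}‖G_n‖²` for all `n ≥ 1` — from (3.8)
(`Suzuki2023b_eq_s301_holds`) and (3.9). RH-CONSEQUENCE (explicit binder).
[cite: Suzuki2023b, Thm. 1.1, p. 2 L100–113; §3.4, p. 8–9] -/
theorem Suzuki2023b_thm11_onlyif_holds : Suzuki2023b_thm11_onlyif :=
  Suzuki2023b_thm11_onlyif_of_eq_s301 Suzuki2023b_eq_s301_holds

/-- **[Su23b] Theorem 1.1 (discharge of `Suzuki2023b_thm11`)**: "A necessary and sufficient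
condition for the Riemann hypothesis is that `λ_n = (2π)^{−1}‖G_n‖²_{L²(ℝ)}` holds for all
positive integers `n`." LABEL (l.1): RH-EQUIVALENT, printed both ways — Li's criterion
re-expressed; typing and proving it fixes WHICH identity is equivalent to RH; nothing here bears
on the truth of RH. [cite: Suzuki2023b, Thm. 1.1, p. 2 L100–113] -/
theorem Suzuki2023b_thm11_holds : Suzuki2023b_thm11 :=
  Suzuki2023b_thm11_of_eq_s301 Suzuki2023b_eq_s301_holds

end Literature.NumberTheory.LFunctions
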